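import Literature.NumberTheory.Automorphic.UnitaryRankOneUnramifiedCharacters
import Literature.NumberTheory.Automorphic.HyperspecialUnitaryHeckeTriangularProducts
import Literature.NumberTheory.Automorphic.HyperspecialUnitaryTrivialEigencharacter
import HarnessLib

/-!
# The basic Hecke operators of `ℋ(U(3), K₀)` and `ℋ(U(2), K₀)` evaluated: `𝒮(1_{K₀ t K₀}) = Q·(x^{(1,0,-1)} + x^{(-1,0,1)}) + (√Q - 1)`
# (`t = diag(ϖ, 1, ϖ⁻¹)`), `𝒮(1_{K₀ t K₀}) = √Q·(x^{(1,-1)} + x^{(-1,1)}) + (√Q - 1)` (`t = diag(ϖ, ϖ⁻¹)`), `Q = #𝓀 = q_F²`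
# (Cartier §IV (4.2); Rogawski §4.5)

Topic `NumberTheory/Automorphic`; namespace `Literature.NumberTheory.Automorphic.HermitianLattice[.UnramifiedLocalConjDatum]`
(lane `lit-hodgefound`, Track 2 foundations; seat `lit-hodgefound-p11`, generation 46, row g46-#6).  THEOREMS ONLY: no definition,
no named fact, no instance, no notation.  Sequel of `UnitaryRankOneUnramifiedCharacters` (g46-#5: `ℋ = ℂ[T₁]`, `𝒮(T₁) = X`,
unramified characters `λ_β`), `UnitaryRankOneSatakeClassical` (g46-#3: `W`-symmetry of `𝒮`), `UnramifiedTraceZeroLatticeIndex`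
(g46-#1: the trace-zero balls `L_γ`, `[L_1 : L_0] = √Q`) and `HyperspecialUnitaryHeckeTriangularProducts` (g36: bottom coefficient and
support of `𝒮(c_a)`).

## The mathematics

`K` a `ℤᵐ⁰`-valued field with an unramified conjugation datum `hd : UnramifiedLocalConjDatum σ ϖ`, `σ ≠ id`, finite residue field
`𝓀` of cardinality `Q` (a perfect square, `√Q = Nat.sqrt Q`, g46-#1); `G = U(σ, J₀)` in three variables, `K₀ = G ∩ GL₃(𝒪)`
hyperspecial, `t = diag(ϖ, 1, ϖ⁻¹) = t_{ℓ₁}`, `ℓ_m = (m, 0, -m)`, `c = 1_{K₀tK₀} ∈ ℋ(G, K₀)` THE BASIC HECKE OPERATOR, and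
`𝒮 = hd.satakeTransform : ℋ → ℂ[ℤ³]`, `𝒮(T)_μ = #{gK₀ ⊆ supp : a(g) = μ} · (√Q)^{-2μ₀}` (Cartier (4.2), the tree's
`coeff_satakeTransform_doubleCosetOperator`).  THE RESULT:

  **`𝒮(c) = Q · (x^{ℓ₁} + x^{ℓ₋₁}) + (√Q - 1) · 1`**  (`satakeTransform_doubleCosetOperator_basic_three`),

i.e. `K₀tK₀/K₀` has `1` coset of Iwasawa exponent `ℓ₋₁` (weight `Q`), `Q²` of exponent `ℓ₁` (weight `Q⁻¹·`), and **`√Q - 1` of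
exponent `0`** (`card_filter_iwasawaExp_basic_zero_three`) — in the Bruhat–Tits tree of `U(3)` (bi-regular of valencies
`q_F³ + 1`, `q_F + 1`) these are the `q_F - 1` hyperspecial vertices at distance `2` from the origin on its own horocycle.
PROOF OF THE MIDDLE COUNT.  (i) The bound `max_{ij} v(g_{ij})` is a `K₀`-bi-invariant of `g ∈ G` (§1, any `N`), so by the Cartan
decomposition a unitriangular `u(α, β) ∈ G` lies in `K₀tK₀` iff `max(v α, v β) = v(ϖ⁻¹)`, iff — using the relation
`β + σβ + ασα = 0` — `v α ≤ 1` and `v β = v(ϖ⁻¹)` (`coe_mem_orbit_basic_iff_three`).  (ii) The cosets `gK₀ ⊆ K₀tK₀` with `a(g) = 0`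
are the `u K₀`, `u = u(a, b)` unitriangular in `K₀tK₀`; by the trace axiom (`y = t₀(b + σb)`, `t₀ + σt₀ = 1`) each is `u(0, β)K₀`
with `β = b - y` TRACE-ZERO of valuation `v(ϖ⁻¹)`, and `u(0, β)K₀ = u(0, β')K₀` iff `v(β - β') ≤ 1`: the map `β ↦ u(0, β)K₀`
identifies them with the non-zero classes of `L_1/L_0` (`L_γ = {v ≤ |ϖ^{-γ}|} ∩ ker(1 + σ)`), which number `[L_1 : L_0] - 1 = √Q - 1`.
(iii) The extreme coefficients and the support `{ℓ₋₁, ℓ₀, ℓ₁}` come from the tree (bottom coefficient `w(ℓ₋₁) = Q`, `W`-symmetry,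
head-sum bound).  CONSEQUENCES (§4): **`λ_β(c) = Q(z + z⁻¹) + √Q - 1`**, `z = β₀β₂⁻¹`
(`heckeEigencharacter_doubleCosetOperator_basic_three`), every complex number is an eigenvalue `λ_β(c)`
(`exists_heckeEigencharacter_doubleCosetOperator_eq_three`), **`ℋ(U(3), K₀) = ℂ[c]`** (`exists_aeval_doubleCosetOperator_basic_three`),
and two algebra homomorphisms `ℋ → B` agreeing on `c` are equal (`algHom_ext_doubleCosetOperator_basic_three`).

## What is formalised (theorems only)

* §1 (any `N`) `forall_v_apply_le_of_unitaryInt_mul` / `_of_mul_unitaryInt`, `forall_v_apply_le_iff_of_eq_mul_mul`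
  (`K₀`-bi-invariance of entry bounds), `forall_v_zpowDiagGL_apply_le_iff`.
* §2 (`N = 3`) `inv_mul_mem_upperUnitriangular_three`, `inv_mul_apply_zero_one_three`, `inv_mul_apply_zero_two_three` (the group law of
  `N(K)` in the coordinates `(α, β)`), `mem_unitaryInt_iff_of_unitriangular_three`, `forall_v_apply_le_iff_of_unitriangular_three`,
  **`coe_mem_orbit_basic_iff_three`**.
* §3 **`card_filter_iwasawaExp_basic_zero_three`** (`= √Q - 1`), `residueCardSqrt_eq_natCast_sqrt`, `coeff_satakeTransform_basic_neg_three`,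
  `coeff_satakeTransform_basic_pos_three`, `coeff_satakeTransform_basic_zero_three`, `coeff_satakeTransform_basic_eq_zero_three`,
  **`satakeTransform_doubleCosetOperator_basic_three`**.
* §4 **`heckeEigencharacter_doubleCosetOperator_basic_three`**, `exists_heckeEigencharacter_doubleCosetOperator_eq_three`,
  `doubleCosetOperator_basic_eq_three`, **`exists_aeval_doubleCosetOperator_basic_three`**, `algHom_ext_doubleCosetOperator_basic_three`,
  **`card_orbit_basic_three`** (rider g46-#6b: the degree `#(K₀tK₀/K₀) = Q² + √Q = q_F⁴ + q_F`, via the trivial point `λ_{β₀} = deg` of g36),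
  `aeval_doubleCosetOperator_basic_injective_three` and **`exists_algEquiv_polynomial_basic_three`** (rider g46-#6c:
  **`ℋ(U(3), K₀) ≅ ℂ[X]`, `X ↦ 1_{K₀tK₀}`** — injectivity because every complex number is an eigenvalue).
* §5 (`N = 2`, `t = diag(ϖ, ϖ⁻¹)`, `δ^{½}(t) = √Q = q_F`, the `(q_F + 1)`-regular tree) the same chain: `inv_mul_apply_zero_one_two`,
  `forall_v_apply_le_iff_of_unitriangular_two`, `mem_unitaryInt_iff_of_unitriangular_two`, **`coe_mem_orbit_basic_iff_two`**,
  **`card_filter_iwasawaExp_basic_zero_two`** (`= √Q - 1`), `coeff_satakeTransform_basic_neg/pos/zero/eq_zero_two`,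
  **`satakeTransform_doubleCosetOperator_basic_two`** (`𝒮(1_{K₀tK₀}) = √Q·(x^{(1,-1)} + x^{(-1,1)}) + (√Q - 1)`),
  **`heckeEigencharacter_doubleCosetOperator_basic_two`** (`λ_β = √Q(z + z⁻¹) + √Q - 1`, `z = β₀β₁⁻¹`),
  `exists_heckeEigencharacter_doubleCosetOperator_eq_two`, `doubleCosetOperator_basic_eq_two`, **`exists_aeval_doubleCosetOperator_basic_two`**,
  `algHom_ext_doubleCosetOperator_basic_two`, **`card_orbit_basic_two`** (rider g46-#6b: `#(K₀tK₀/K₀) = Q + √Q = q_F² + q_F`),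
  `aeval_doubleCosetOperator_basic_injective_two`, **`exists_algEquiv_polynomial_basic_two`** (rider g46-#6c: `ℋ(U(2), K₀) ≅ ℂ[X]`).

## References
* [CartierCorvallis1979] P. Cartier, *Representations of 𝔭-adic groups: a survey*, PSPM 33.1 (1979), §IV (4.2) (the Satake transform as
  an Iwasawa count), Thm. 4.1, Cor. 4.2.
* [Rogawski1990] J. D. Rogawski, *Automorphic Representations of Unitary Groups in Three Variables*, Ann. of Math. Stud. 123 (1990),
  §1.10 p. 14 (`N`, `u(x, z)`), §4.5 p. 50.
* [BruhatTits1972] F. Bruhat, J. Tits, *Groupes réductifs sur un corps local I*, Publ. Math. IHÉS 41 (1972), (4.4.3)–(4.4.4).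
* [Satake1963] I. Satake, Publ. Math. IHÉS 18 (1963), §§6–7.
* [Serre1979] J.-P. Serre, *Local Fields*, GTM 67 (1979), Ch. V §2 (trace of an unramified extension).
* [ShimuraIATAF1971] G. Shimura, *Introduction to the Arithmetic Theory of Automorphic Functions* (1971), §3.1 Prop. 3.3 (`deg`).
-/

noncomputable section

open scoped Valued WithZero Matrix MatrixGroups Pointwise
open MonoidAlgebra Representation Finset MulAction ConjAct Polynomial

namespace Literature.NumberTheory.Automorphic.HermitianLattice

open Literature.NumberTheory.Automorphic.CartanUnique Literature.NumberTheory.Automorphic.SymplecticCartan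
  Literature.NumberTheory.Automorphic

variable {K : Type*} [Field K] [Valued K ℤᵐ⁰] {σ : K →+* K} {ϖ : K} {N : ℕ}

/-! ## §1 Entry bounds are `K₀`-bi-invariant -/

/-- Left multiplication by `k ∈ K₀` preserves the bound `v(g_{ij}) ≤ γ` on all entries. [cite: Tits1979, §3.3.3]
[cite: BruhatTits1972, (4.4.3)] -/
theorem forall_v_apply_le_of_unitaryInt_mul (hvσ : ∀ x, Valued.v (σ x) = Valued.v x)
    {k : unitaryGroupOfForm σ ((StdForm.antidiagonal N).over K)} (hk : k ∈ unitaryInt σ ((StdForm.antidiagonal N).over K))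
    {g : unitaryGroupOfForm σ ((StdForm.antidiagonal N).over K)} {γ : ℤᵐ⁰}
    (hg : ∀ i j, Valued.v (((g : GL (Fin N) K) : Matrix (Fin N) (Fin N) K) i j) ≤ γ) (i j : Fin N) :
    Valued.v ((((k * g : unitaryGroupOfForm σ ((StdForm.antidiagonal N).over K)) : GL (Fin N) K) : Matrix (Fin N) (Fin N) K) i j) ≤ γ := by
  have hk' := (mem_unitaryInt_iff_forall_v_le_one hvσ).1 hk
  rw [Subgroup.coe_mul, Units.val_mul, Matrix.mul_apply]
  refine Valuation.map_sum_le _ fun l _ => ?_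
  rw [map_mul]
  calc Valued.v (((k : GL (Fin N) K) : Matrix (Fin N) (Fin N) K) i l) * Valued.v (((g : GL (Fin N) K) : Matrix (Fin N) (Fin N) K) l j)
      ≤ 1 * γ := mul_le_mul' (hk' i l) (hg l j)
    _ = γ := one_mul γ

/-- Right multiplication by `k ∈ K₀` preserves the bound `v(g_{ij}) ≤ γ` on all entries. [cite: Tits1979, §3.3.3]
[cite: BruhatTits1972, (4.4.3)] -/
theorem forall_v_apply_le_of_mul_unitaryInt (hvσ : ∀ x, Valued.v (σ x) = Valued.v x)
    {k : unitaryGroupOfForm σ ((StdForm.antidiagonal N).over K)} (hk : k ∈ unitaryInt σ ((StdForm.antidiagonal N).over K))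
    {g : unitaryGroupOfForm σ ((StdForm.antidiagonal N).over K)} {γ : ℤᵐ⁰}
    (hg : ∀ i j, Valued.v (((g : GL (Fin N) K) : Matrix (Fin N) (Fin N) K) i j) ≤ γ) (i j : Fin N) :
    Valued.v ((((g * k : unitaryGroupOfForm σ ((StdForm.antidiagonal N).over K)) : GL (Fin N) K) : Matrix (Fin N) (Fin N) K) i j) ≤ γ := by
  have hk' := (mem_unitaryInt_iff_forall_v_le_one hvσ).1 hk
  rw [Subgroup.coe_mul, Units.val_mul, Matrix.mul_apply]
  refine Valuation.map_sum_le _ fun l _ => ?_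
  rw [map_mul]
  calc Valued.v (((g : GL (Fin N) K) : Matrix (Fin N) (Fin N) K) i l) * Valued.v (((k : GL (Fin N) K) : Matrix (Fin N) (Fin N) K) l j)
      ≤ γ * 1 := mul_le_mul' (hg i l) (hk' l j)
    _ = γ := mul_one γ

/-- **Entry bounds are constant on double cosets**: if `g' = a g b` with `a, b ∈ K₀` then all entries of `g'` have `v ≤ γ` iff all
entries of `g` do (the first elementary divisor is a `K₀\G/K₀`-invariant). [cite: BruhatTits1972, (4.4.3)] [cite: Tits1979, §3.3.3] -/
theorem forall_v_apply_le_iff_of_eq_mul_mul (hvσ : ∀ x, Valued.v (σ x) = Valued.v x)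
    {a b g g' : unitaryGroupOfForm σ ((StdForm.antidiagonal N).over K)} (ha : a ∈ unitaryInt σ ((StdForm.antidiagonal N).over K))
    (hb : b ∈ unitaryInt σ ((StdForm.antidiagonal N).over K)) (h : g' = a * g * b) (γ : ℤᵐ⁰) :
    (∀ i j, Valued.v (((g' : GL (Fin N) K) : Matrix (Fin N) (Fin N) K) i j) ≤ γ) ↔
      ∀ i j, Valued.v (((g : GL (Fin N) K) : Matrix (Fin N) (Fin N) K) i j) ≤ γ := by
  constructor
  · intro hg'
    have hg : g = a⁻¹ * g' * b⁻¹ := by rw [h]; group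
    rw [hg]
    exact forall_v_apply_le_of_mul_unitaryInt hvσ ((unitaryInt σ _).inv_mem hb)
      (forall_v_apply_le_of_unitaryInt_mul hvσ ((unitaryInt σ _).inv_mem ha) hg')
  · intro hg
    rw [h]
    exact forall_v_apply_le_of_mul_unitaryInt hvσ hb (forall_v_apply_le_of_unitaryInt_mul hvσ ha hg)

/-- The entries of `diag(ϖ^{a_i})` have `v ≤ |ϖ^{-γ}|` iff `-a_i ≤ γ` for all `i`. [cite: BruhatTits1972, (4.4.3)] -/
theorem forall_v_zpowDiagGL_apply_le_iff (hϖ : Valued.v ϖ = WithZero.exp (-1 : ℤ)) (a : Fin N → ℤ) (γ : ℤ) :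
    (∀ i j, Valued.v (((zpowDiagGL (uniformizer_ne_zero hϖ) a : GL (Fin N) K) : Matrix (Fin N) (Fin N) K) i j) ≤ WithZero.exp γ) ↔
      ∀ i, -a i ≤ γ := by
  rw [coe_zpowDiagGL]
  constructor
  · intro h i
    have := h i i
    rwa [Matrix.diagonal_apply_eq, v_uniformizer_zpow hϖ, WithZero.exp_le_exp] at this
  · intro h i j
    by_cases hij : i = j
    · subst hij
      rw [Matrix.diagonal_apply_eq, v_uniformizer_zpow hϖ, WithZero.exp_le_exp]
      exact h i
    · rw [Matrix.diagonal_apply_ne _ hij, map_zero]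
      exact zero_le

/-! ## §2 `U(3)`: the group law of `N(K)` in coordinates and the double coset of a unipotent element -/

omit [Valued K ℤᵐ⁰] in
/-- `g⁻¹h` is upper unitriangular for `g, h` upper unitriangular. [folklore] -/
private theorem inv_mul_mem_upperUnitriangular_three {g h : unitaryGroupOfForm σ ((StdForm.antidiagonal 3).over K)}
    (hg : (g : GL (Fin 3) K) ∈ upperUnitriangular (Fin 3) K) (hh : (h : GL (Fin 3) K) ∈ upperUnitriangular (Fin 3) K) :
    ((g⁻¹ * h : unitaryGroupOfForm σ ((StdForm.antidiagonal 3).over K)) : GL (Fin 3) K) ∈ upperUnitriangular (Fin 3) K := by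
  rw [Subgroup.coe_mul, Subgroup.coe_inv]
  exact (upperUnitriangular (Fin 3) K).mul_mem ((upperUnitriangular (Fin 3) K).inv_mem hg) hh

omit [Valued K ℤᵐ⁰] in
/-- **The group law of `N(K) ≤ U(3)`, `(0,1)`-coordinate**: `(u(α,β)⁻¹ u(α',β'))₀₁ = α' - α`. [cite: Rogawski1990, §1.10 p. 14] -/
theorem inv_mul_apply_zero_one_three (hσσ : ∀ x, σ (σ x) = x) {g h : unitaryGroupOfForm σ ((StdForm.antidiagonal 3).over K)}
    (hg : (g : GL (Fin 3) K) ∈ upperUnitriangular (Fin 3) K) (hh : (h : GL (Fin 3) K) ∈ upperUnitriangular (Fin 3) K) :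
    (((g⁻¹ * h : unitaryGroupOfForm σ ((StdForm.antidiagonal 3).over K)) : GL (Fin 3) K) : Matrix (Fin 3) (Fin 3) K) 0 1 =
      ((h : GL (Fin 3) K) : Matrix (Fin 3) (Fin 3) K) 0 1 - ((g : GL (Fin 3) K) : Matrix (Fin 3) (Fin 3) K) 0 1 := by
  have hTh := blockTriangular_of_mem_upperUnitriangular hh
  have r0 : Fin.rev (0 : Fin 3) = 2 := by decide
  have r1 : Fin.rev (1 : Fin 3) = 1 := by decide
  rw [Subgroup.coe_mul, Units.val_mul, Matrix.mul_apply, Fin.sum_univ_three]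
  simp only [coe_inv_apply_unitary, r0, r1, show Fin.rev (2 : Fin 3) = 0 from by decide]
  rw [apply_self_of_mem_upperUnitriangular hg, apply_one_two_eq_three hg, apply_self_of_mem_upperUnitriangular hh,
    hTh (show (1 : Fin 3) < 2 by decide), map_one, map_neg, hσσ]
  ring

omit [Valued K ℤᵐ⁰] in
/-- **The group law of `N(K) ≤ U(3)`, `(0,2)`-coordinate**: `(u(α,β)⁻¹ u(α',β'))₀₂ = β' + α σ(α') + σβ`
(Rogawski: `u(x,z)u(x',z') = u(x+x', z+z'+x̄'x)`-type law). [cite: Rogawski1990, §1.10 p. 14] -/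
theorem inv_mul_apply_zero_two_three (hσσ : ∀ x, σ (σ x) = x) {g h : unitaryGroupOfForm σ ((StdForm.antidiagonal 3).over K)}
    (hg : (g : GL (Fin 3) K) ∈ upperUnitriangular (Fin 3) K) (hh : (h : GL (Fin 3) K) ∈ upperUnitriangular (Fin 3) K) :
    (((g⁻¹ * h : unitaryGroupOfForm σ ((StdForm.antidiagonal 3).over K)) : GL (Fin 3) K) : Matrix (Fin 3) (Fin 3) K) 0 2 =
      ((h : GL (Fin 3) K) : Matrix (Fin 3) (Fin 3) K) 0 2 +
        ((g : GL (Fin 3) K) : Matrix (Fin 3) (Fin 3) K) 0 1 * σ (((h : GL (Fin 3) K) : Matrix (Fin 3) (Fin 3) K) 0 1) +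
          σ (((g : GL (Fin 3) K) : Matrix (Fin 3) (Fin 3) K) 0 2) := by
  have r0 : Fin.rev (0 : Fin 3) = 2 := by decide
  have r1 : Fin.rev (1 : Fin 3) = 1 := by decide
  rw [Subgroup.coe_mul, Units.val_mul, Matrix.mul_apply, Fin.sum_univ_three]
  simp only [coe_inv_apply_unitary, r0, r1, show Fin.rev (2 : Fin 3) = 0 from by decide]
  rw [apply_self_of_mem_upperUnitriangular hg, apply_one_two_eq_three hg, apply_self_of_mem_upperUnitriangular hh,
    apply_one_two_eq_three hh, map_one, map_neg, hσσ]
  ring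

namespace UnramifiedLocalConjDatum

/-- A unitriangular `w = u(α, β) ∈ U(3)` lies in `K₀` iff `v α ≤ 1` and `v β ≤ 1`. [cite: Rogawski1990, §1.10 p. 14] -/
theorem mem_unitaryInt_iff_of_unitriangular_three (hd : UnramifiedLocalConjDatum σ ϖ)
    {w : unitaryGroupOfForm σ ((StdForm.antidiagonal 3).over K)} (hw : (w : GL (Fin 3) K) ∈ upperUnitriangular (Fin 3) K) :
    w ∈ unitaryInt σ ((StdForm.antidiagonal 3).over K) ↔
      Valued.v (((w : GL (Fin 3) K) : Matrix (Fin 3) (Fin 3) K) 0 1) ≤ 1 ∧ Valued.v (((w : GL (Fin 3) K) : Matrix (Fin 3) (Fin 3) K) 0 2) ≤ 1 := by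
  have h1 := hd.mem_borelLatticeU_inf_unitaryInt_iff (x := w)
  have h2 := hd.mem_borelInt_iff_three (g := w)
  exact ⟨fun hw0 => (h2.1 (h1.2 ⟨hw, hw0⟩)).2, fun hv => (h1.1 (h2.2 ⟨hw, hv.1, hv.2⟩)).2⟩

end UnramifiedLocalConjDatum

/-- The entries of a unitriangular `u(α, β) ∈ U(3)` have `v ≤ |ϖ^{-γ}|` (`γ ≥ 0`) iff `v α, v β ≤ |ϖ^{-γ}|`.
[cite: Rogawski1990, §1.10 p. 14] -/
theorem forall_v_apply_le_iff_of_unitriangular_three (hvσ : ∀ x, Valued.v (σ x) = Valued.v x)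
    {u : unitaryGroupOfForm σ ((StdForm.antidiagonal 3).over K)} (hu : (u : GL (Fin 3) K) ∈ upperUnitriangular (Fin 3) K)
    {γ : ℤ} (hγ : 0 ≤ γ) :
    (∀ i j, Valued.v (((u : GL (Fin 3) K) : Matrix (Fin 3) (Fin 3) K) i j) ≤ WithZero.exp γ) ↔
      Valued.v (((u : GL (Fin 3) K) : Matrix (Fin 3) (Fin 3) K) 0 1) ≤ WithZero.exp γ ∧
        Valued.v (((u : GL (Fin 3) K) : Matrix (Fin 3) (Fin 3) K) 0 2) ≤ WithZero.exp γ := by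
  have hT := blockTriangular_of_mem_upperUnitriangular hu
  have h1 : (1 : ℤᵐ⁰) ≤ WithZero.exp γ := by rw [← WithZero.exp_zero, WithZero.exp_le_exp]; exact hγ
  refine ⟨fun h => ⟨h 0 1, h 0 2⟩, fun h i j => ?_⟩
  fin_cases i <;> fin_cases j
  · rw [apply_self_of_mem_upperUnitriangular hu, map_one]; exact h1
  · exact h.1
  · exact h.2
  · rw [hT (by decide), map_zero]; exact zero_le
  · rw [apply_self_of_mem_upperUnitriangular hu, map_one]; exact h1
  · show Valued.v (((u : GL (Fin 3) K) : Matrix (Fin 3) (Fin 3) K) 1 2) ≤ _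
    rw [apply_one_two_eq_three hu, Valuation.map_neg, hvσ]; exact h.1
  · rw [hT (by decide), map_zero]; exact zero_le
  · rw [hT (by decide), map_zero]; exact zero_le
  · rw [apply_self_of_mem_upperUnitriangular hu, map_one]; exact h1

namespace UnramifiedLocalConjDatum

/-- **The double coset of a unipotent element**: a unitriangular `u(α, β) ∈ U(3)` lies in `K₀ t K₀`, `t = diag(ϖ, 1, ϖ⁻¹)`, iff
`v α ≤ 1` and `v β = |ϖ⁻¹|` (the first elementary divisor is `ϖ⁻¹`; `v α = |ϖ⁻¹|` is excluded by `β + σβ + ασα = 0`).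
[cite: BruhatTits1972, (4.4.3)] [cite: Rogawski1990, §1.10 p. 14] -/
theorem coe_mem_orbit_basic_iff_three (hd : UnramifiedLocalConjDatum σ ϖ)
    {u : unitaryGroupOfForm σ ((StdForm.antidiagonal 3).over K)} (hu : (u : GL (Fin 3) K) ∈ upperUnitriangular (Fin 3) K) :
    (u : unitaryGroupOfForm σ ((StdForm.antidiagonal 3).over K) ⧸ unitaryInt σ ((StdForm.antidiagonal 3).over K)) ∈
        MulAction.orbit (unitaryInt σ ((StdForm.antidiagonal 3).over K))
          ((⟨zpowDiagGL (uniformizer_ne_zero hd.vϖ) (fun i : Fin 3 => (1 : ℤ) * (1 - (i : ℕ))),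
              zpowDiagGL_mem_unitaryGroupOfForm hd.σϖ _ (rev_linear_three 1)⟩ : unitaryGroupOfForm σ ((StdForm.antidiagonal 3).over K)) :
            unitaryGroupOfForm σ ((StdForm.antidiagonal 3).over K) ⧸ unitaryInt σ ((StdForm.antidiagonal 3).over K)) ↔
      Valued.v (((u : GL (Fin 3) K) : Matrix (Fin 3) (Fin 3) K) 0 1) ≤ 1 ∧
        Valued.v (((u : GL (Fin 3) K) : Matrix (Fin 3) (Fin 3) K) 0 2) ≤ WithZero.exp 1 ∧
          ¬ Valued.v (((u : GL (Fin 3) K) : Matrix (Fin 3) (Fin 3) K) 0 2) ≤ 1 := by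
  have hϖ0 := uniformizer_ne_zero hd.vϖ
  have hrel := apply_add_map_apply_eq_three hd.σσ hu
  -- entries of `diag(ϖ^a)`
  have hdiag : ∀ (a : Fin 3 → ℤ) (ha : ∀ i, a (Fin.rev i) = -a i) (γ : ℤ),
      (∀ i j, Valued.v ((((⟨zpowDiagGL hϖ0 a, zpowDiagGL_mem_unitaryGroupOfForm hd.σϖ _ ha⟩ :
          unitaryGroupOfForm σ ((StdForm.antidiagonal 3).over K)) : GL (Fin 3) K) : Matrix (Fin 3) (Fin 3) K) i j) ≤ WithZero.exp γ) ↔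
        ∀ i, -a i ≤ γ := fun a ha γ => forall_v_zpowDiagGL_apply_le_iff hd.vϖ a γ
  have h01 : (0 : ℤ) ≤ 1 := zero_le_one
  constructor
  · intro hmem
    obtain ⟨a, ha, b, hb, hab⟩ := (heckeAlgebra.coe_mem_orbit_coe_iff (unitaryInt σ ((StdForm.antidiagonal 3).over K)) _ u).1 hmem
    have key : ∀ γ : ℤ, 0 ≤ γ →
        ((Valued.v (((u : GL (Fin 3) K) : Matrix (Fin 3) (Fin 3) K) 0 1) ≤ WithZero.exp γ ∧
          Valued.v (((u : GL (Fin 3) K) : Matrix (Fin 3) (Fin 3) K) 0 2) ≤ WithZero.exp γ) ↔ ∀ i : Fin 3, -((1 : ℤ) * (1 - (i : ℕ))) ≤ γ) :=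
      fun γ hγ => by
        rw [← forall_v_apply_le_iff_of_unitriangular_three hd.vσ hu hγ, forall_v_apply_le_iff_of_eq_mul_mul hd.vσ ha hb hab,
          hdiag _ (rev_linear_three 1)]
    have h1 := (key 1 h01).2 fun i => by fin_cases i <;> simp
    have h0 : ¬ (Valued.v (((u : GL (Fin 3) K) : Matrix (Fin 3) (Fin 3) K) 0 1) ≤ 1 ∧
        Valued.v (((u : GL (Fin 3) K) : Matrix (Fin 3) (Fin 3) K) 0 2) ≤ 1) := fun h => by
      have := (key 0 le_rfl).1 (by rw [WithZero.exp_zero]; exact h) 2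
      simp at this
    -- the relation excludes `v α = |ϖ⁻¹|`
    have hα : Valued.v (((u : GL (Fin 3) K) : Matrix (Fin 3) (Fin 3) K) 0 1) ≤ 1 := by
      by_contra hα
      have hvne : Valued.v (((u : GL (Fin 3) K) : Matrix (Fin 3) (Fin 3) K) 0 1) ≠ 0 := fun h0' => by
        rw [h0'] at hα; exact hα zero_le
      obtain ⟨k, hk⟩ : ∃ k : ℤ, Valued.v (((u : GL (Fin 3) K) : Matrix (Fin 3) (Fin 3) K) 0 1) = WithZero.exp k :=
        ⟨_, (WithZero.exp_log hvne).symm⟩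
      have hk1 : k = 1 := by
        have hle := h1.1
        rw [hk, WithZero.exp_le_exp] at hle
        rw [hk, ← WithZero.exp_zero, WithZero.exp_le_exp, not_le] at hα
        omega
      have heq : ((u : GL (Fin 3) K) : Matrix (Fin 3) (Fin 3) K) 0 1 * σ (((u : GL (Fin 3) K) : Matrix (Fin 3) (Fin 3) K) 0 1) =
          -(((u : GL (Fin 3) K) : Matrix (Fin 3) (Fin 3) K) 0 2 + σ (((u : GL (Fin 3) K) : Matrix (Fin 3) (Fin 3) K) 0 2)) := by
        linear_combination hrel
      have hle2 : Valued.v (((u : GL (Fin 3) K) : Matrix (Fin 3) (Fin 3) K) 0 1 * σ (((u : GL (Fin 3) K) : Matrix (Fin 3) (Fin 3) K) 0 1)) ≤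
          WithZero.exp 1 := by
        rw [heq, Valuation.map_neg]
        refine le_trans (Valuation.map_add _ _ _) (max_le h1.2 ?_)
        rw [hd.vσ]; exact h1.2
      rw [map_mul, hd.vσ, hk, hk1, ← WithZero.exp_add, WithZero.exp_le_exp] at hle2
      omega
    exact ⟨hα, h1.2, fun hβ => h0 ⟨hα, hβ⟩⟩
  · rintro ⟨hα, hβ, hβ'⟩
    obtain ⟨a, ha, hmk⟩ := heckeCosetMk_zpowDiagGL_eq_of_unitary hd u
    obtain ⟨k₁, hk₁, k₂, hk₂, hu'⟩ := (heckeAlgebra.heckeCosetMk_eq_iff (unitaryInt σ ((StdForm.antidiagonal 3).over K)) _ _).1 hmk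
    have key : ∀ γ : ℤ, 0 ≤ γ →
        ((Valued.v (((u : GL (Fin 3) K) : Matrix (Fin 3) (Fin 3) K) 0 1) ≤ WithZero.exp γ ∧
          Valued.v (((u : GL (Fin 3) K) : Matrix (Fin 3) (Fin 3) K) 0 2) ≤ WithZero.exp γ) ↔ ∀ i : Fin 3, -a i ≤ γ) := fun γ hγ => by
      rw [← forall_v_apply_le_iff_of_unitriangular_three hd.vσ hu hγ, forall_v_apply_le_iff_of_eq_mul_mul hd.vσ hk₁ hk₂ hu', hdiag _ ha.2]
    have h1 : ∀ i, -a i ≤ 1 :=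
      (key 1 h01).1 ⟨le_trans hα (by rw [← WithZero.exp_zero, WithZero.exp_le_exp]; exact h01), hβ⟩
    have h0 : ¬ ∀ i, -a i ≤ 0 := fun h => hβ' (by
      have := ((key 0 le_rfl).2 h).2
      rwa [WithZero.exp_zero] at this)
    have hlin := eq_linear_three_of_rev a ha.2
    have ha1 : a 1 = 0 := by
      have := congrFun hlin 1; simp at this; exact this
    have ha2 : a 2 = -a 0 := by
      have := congrFun hlin 2
      simp only [Fin.isValue, Fin.val_two, Nat.cast_ofNat] at this
      linear_combination this
    have hmono : a 1 ≤ a 0 := ha.1 (show (0 : Fin 3) ≤ 1 by decide)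
    have ha0 : a 0 = 1 := by
      have h12 := h1 2
      by_contra hne
      refine h0 fun i => ?_
      fin_cases i
      · show -a 0 ≤ 0; omega
      · show -a 1 ≤ 0; omega
      · show -a 2 ≤ 0; omega
    have haℓ : a = fun i : Fin 3 => (1 : ℤ) * (1 - (i : ℕ)) := by rw [hlin, ha0]
    subst haℓ
    exact (heckeAlgebra.coe_mem_orbit_coe_iff (unitaryInt σ ((StdForm.antidiagonal 3).over K)) _ u).2 ⟨k₁, hk₁, k₂, hk₂, hu'⟩

/-! ## §3 The middle coefficient `#{gK₀ ⊆ K₀tK₀ : a(g) = 0} = √Q - 1` and the Satake transform of `1_{K₀tK₀}` -/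

/-- **THE MIDDLE COEFFICIENT**: the left cosets `gK₀ ⊆ K₀ t K₀` (`t = diag(ϖ, 1, ϖ⁻¹)`) of Iwasawa exponent `a(g) = 0` number
`√Q - 1` (`Q = #𝓀`): they are the `u(0, β)K₀` with `β` trace-zero of valuation `|ϖ⁻¹|`, taken modulo the trace-zero integers —
the non-zero classes of `L_1/L_0`, `[L_1 : L_0] = √Q`. [cite: CartierCorvallis1979, §IV (4.2)] [cite: Serre1979, Ch. V §2]
[cite: Rogawski1990, §1.10 p. 14] -/
theorem card_filter_iwasawaExp_basic_zero_three (hd : UnramifiedLocalConjDatum σ ϖ) (hσ : ∃ x : K, σ x ≠ x) [Finite 𝓀[K]]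
    [IsHeckeTriple (⊤ : Submonoid (unitaryGroupOfForm σ ((StdForm.antidiagonal 3).over K))) (unitaryInt σ ((StdForm.antidiagonal 3).over K))
      (unitaryInt σ ((StdForm.antidiagonal 3).over K))]
    [DecidablePred fun α : unitaryGroupOfForm σ ((StdForm.antidiagonal 3).over K) ⧸ unitaryInt σ ((StdForm.antidiagonal 3).over K) =>
      hd.iwasawaExp α.out = (0 : Fin 3 → ℤ)] :
    ((finite_orbit_quotient (unitaryInt σ ((StdForm.antidiagonal 3).over K))
        (⟨zpowDiagGL (uniformizer_ne_zero hd.vϖ) (fun i : Fin 3 => (1 : ℤ) * (1 - (i : ℕ))),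
            zpowDiagGL_mem_unitaryGroupOfForm hd.σϖ _ (rev_linear_three 1)⟩ : unitaryGroupOfForm σ ((StdForm.antidiagonal 3).over K))).toFinset.filter
        fun α => hd.iwasawaExp α.out = (0 : Fin 3 → ℤ)).card = Nat.sqrt (Nat.card 𝓀[K]) - 1 := by
  classical
  have hϖ0 := uniformizer_ne_zero hd.vϖ
  set t : unitaryGroupOfForm σ ((StdForm.antidiagonal 3).over K) :=
    ⟨zpowDiagGL (uniformizer_ne_zero hd.vϖ) (fun i : Fin 3 => (1 : ℤ) * (1 - (i : ℕ))),
      zpowDiagGL_mem_unitaryGroupOfForm hd.σϖ _ (rev_linear_three 1)⟩ with ht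
  set S := ((finite_orbit_quotient (unitaryInt σ ((StdForm.antidiagonal 3).over K)) t).toFinset.filter
    fun α => hd.iwasawaExp α.out = (0 : Fin 3 → ℤ)) with hS
  have hmemS : ∀ α, α ∈ S ↔ α ∈ MulAction.orbit (unitaryInt σ ((StdForm.antidiagonal 3).over K))
      (t : unitaryGroupOfForm σ ((StdForm.antidiagonal 3).over K) ⧸ unitaryInt σ ((StdForm.antidiagonal 3).over K)) ∧
        hd.iwasawaExp α.out = 0 := fun α => by
    rw [hS, Finset.mem_filter, Set.Finite.mem_toFinset]
  -- the trace-zero balls `L_1 ⊇ L_0`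
  set L1 : AddSubgroup K := (Valued.v : Valuation K ℤᵐ⁰).leAddSubgroup (WithZero.exp (1 : ℤ)) ⊓ (AddMonoidHom.id K + σ.toAddMonoidHom).ker
    with hL1
  set L0 : AddSubgroup K := (Valued.v : Valuation K ℤᵐ⁰).leAddSubgroup (WithZero.exp (0 : ℤ)) ⊓ (AddMonoidHom.id K + σ.toAddMonoidHom).ker
    with hL0
  have hmemL1 : ∀ β : K, β ∈ L1 ↔ Valued.v β ≤ WithZero.exp 1 ∧ β + σ β = 0 := fun β => by
    rw [hL1, AddSubgroup.mem_inf, Valuation.mem_leAddSubgroup_iff, mem_ker_id_add_iff]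
  have hmemL0 : ∀ β : K, β ∈ L0 ↔ Valued.v β ≤ 1 ∧ β + σ β = 0 := fun β => by
    rw [hL0, AddSubgroup.mem_inf, Valuation.mem_leAddSubgroup_iff, mem_ker_id_add_iff, WithZero.exp_zero]
  have hidx : L0.relIndex L1 = Nat.sqrt (Nat.card 𝓀[K]) := by
    rw [hL0, hL1, hd.relIndex_leAddSubgroup_inf_ker_add_exp hσ 1 0]; simp
  -- the unipotent section `β ↦ u(0, β)`
  have hex : ∀ β : L1, ∃ g : unitaryGroupOfForm σ ((StdForm.antidiagonal 3).over K), (g : GL (Fin 3) K) ∈ upperUnitriangular (Fin 3) K ∧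
      ((g : GL (Fin 3) K) : Matrix (Fin 3) (Fin 3) K) 0 1 = 0 ∧ ((g : GL (Fin 3) K) : Matrix (Fin 3) (Fin 3) K) 0 2 = (β : K) := fun β =>
    hd.exists_unitriangular_apply_eq_three (α := 0) (β := (β : K)) (by rw [map_zero, mul_zero, add_zero]; exact ((hmemL1 β).1 β.2).2)
  choose u huU hu01 hu02 using hex
  have hσβ : ∀ β : L1, σ (β : K) = -(β : K) := fun β => by
    have := ((hmemL1 β).1 β.2).2; linear_combination this
  have hvβ : ∀ β : L1, Valued.v (β : K) ≤ WithZero.exp 1 := fun β => ((hmemL1 β).1 β.2).1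
  have hau : ∀ β : L1, hd.iwasawaExp (u β) = 0 := fun β => by
    have := hd.iwasawaExp_unipotent_mul_torus (huU β) (t := 1) (a := 0) (by rw [OneMemClass.coe_one, zpowDiagGL_zero])
    rwa [mul_one] at this
  -- (F1) the fibres: `u(0,β)K₀ = u(0,β')K₀ ↔ v(β' - β) ≤ 1`
  have hF1 : ∀ β β' : L1,
      ((u β : unitaryGroupOfForm σ ((StdForm.antidiagonal 3).over K)) :
          unitaryGroupOfForm σ ((StdForm.antidiagonal 3).over K) ⧸ unitaryInt σ ((StdForm.antidiagonal 3).over K)) = (u β' : _) ↔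
        Valued.v ((β' : K) - β) ≤ 1 := fun β β' => by
    rw [QuotientGroup.eq, hd.mem_unitaryInt_iff_of_unitriangular_three (inv_mul_mem_upperUnitriangular_three (huU β) (huU β')),
      inv_mul_apply_zero_one_three hd.σσ (huU β) (huU β'), inv_mul_apply_zero_two_three hd.σσ (huU β) (huU β'), hu01, hu01, hu02, hu02,
      hσβ, sub_zero, map_zero, zero_mul, add_zero, ← sub_eq_add_neg]
    exact ⟨fun h => h.2, fun h => ⟨zero_le, h⟩⟩
  -- (F2) `u(0,β)K₀ ∈ S ↔ v β > 1`
  have hF2 : ∀ β : L1, ((u β : unitaryGroupOfForm σ ((StdForm.antidiagonal 3).over K)) :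
      unitaryGroupOfForm σ ((StdForm.antidiagonal 3).over K) ⧸ unitaryInt σ ((StdForm.antidiagonal 3).over K)) ∈ S ↔
        ¬ Valued.v (β : K) ≤ 1 := fun β => by
    rw [hmemS, ht, hd.coe_mem_orbit_basic_iff_three (huU β), hu01, hu02, map_zero]
    obtain ⟨k, hk⟩ := QuotientGroup.mk_out_eq_mul (unitaryInt σ ((StdForm.antidiagonal 3).over K)) (u β)
    rw [hk, hd.iwasawaExp_mul_of_mem_unitaryInt _ k.2, hau]
    exact ⟨fun h => h.1.2.2, fun h => ⟨⟨zero_le, hvβ β, h⟩, rfl⟩⟩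
  -- (F3) `S ⊆` image
  have hF3 : ∀ α ∈ S, ∃ β : L1, ((u β : unitaryGroupOfForm σ ((StdForm.antidiagonal 3).over K)) :
      unitaryGroupOfForm σ ((StdForm.antidiagonal 3).over K) ⧸ unitaryInt σ ((StdForm.antidiagonal 3).over K)) = α := fun α hα => by
    obtain ⟨horb, ha0⟩ := (hmemS α).1 hα
    obtain ⟨p, hp, k, hk, hgpk⟩ := hd.isIwasawaExponent.exists_eq_mul α.out
    have hap : hd.iwasawaExp p = 0 := by rw [← ha0, hgpk, hd.iwasawaExp_mul_of_mem_unitaryInt _ hk]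
    have hpU := hd.coe_mem_upperUnitriangular_of_iwasawaExp_eq_zero hp hap
    have hpα : ((p : unitaryGroupOfForm σ ((StdForm.antidiagonal 3).over K)) :
        unitaryGroupOfForm σ ((StdForm.antidiagonal 3).over K) ⧸ unitaryInt σ ((StdForm.antidiagonal 3).over K)) = α := by
      rw [← QuotientGroup.out_eq' α, QuotientGroup.eq, hgpk, inv_mul_cancel_left]
      exact hk
    rw [← hpα, ht, hd.coe_mem_orbit_basic_iff_three hpU] at horb
    obtain ⟨hva, hvb, -⟩ := horb
    obtain ⟨t₀, ht₀v, ht₀⟩ := hd.trace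
    have hrel := apply_add_map_apply_eq_three hd.σσ hpU
    obtain ⟨y, hy⟩ : ∃ y : K, y = t₀ * (((p : GL (Fin 3) K) : Matrix (Fin 3) (Fin 3) K) 0 2 + σ (((p : GL (Fin 3) K) : Matrix (Fin 3) (Fin 3) K) 0 2)) :=
      ⟨_, rfl⟩
    have hyv : Valued.v y ≤ 1 := by
      rw [hy, map_mul, show ((p : GL (Fin 3) K) : Matrix (Fin 3) (Fin 3) K) 0 2 + σ (((p : GL (Fin 3) K) : Matrix (Fin 3) (Fin 3) K) 0 2) =
        -(((p : GL (Fin 3) K) : Matrix (Fin 3) (Fin 3) K) 0 1 * σ (((p : GL (Fin 3) K) : Matrix (Fin 3) (Fin 3) K) 0 1)) by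
          linear_combination hrel, Valuation.map_neg, map_mul, hd.vσ]
      calc Valued.v t₀ * (Valued.v (((p : GL (Fin 3) K) : Matrix (Fin 3) (Fin 3) K) 0 1) *
            Valued.v (((p : GL (Fin 3) K) : Matrix (Fin 3) (Fin 3) K) 0 1)) ≤ 1 * (1 * 1) := mul_le_mul' ht₀v (mul_le_mul' hva hva)
        _ = 1 := by rw [one_mul, one_mul]
    have hyσ : y + σ y = ((p : GL (Fin 3) K) : Matrix (Fin 3) (Fin 3) K) 0 2 + σ (((p : GL (Fin 3) K) : Matrix (Fin 3) (Fin 3) K) 0 2) := by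
      rw [hy, map_mul, map_add, hd.σσ]
      linear_combination (((p : GL (Fin 3) K) : Matrix (Fin 3) (Fin 3) K) 0 2 + σ (((p : GL (Fin 3) K) : Matrix (Fin 3) (Fin 3) K) 0 2)) * ht₀
    have hβmem : ((p : GL (Fin 3) K) : Matrix (Fin 3) (Fin 3) K) 0 2 - y ∈ L1 := by
      rw [hmemL1]
      refine ⟨le_trans (Valuation.map_sub _ _ _) (max_le hvb (le_trans hyv ?_)), ?_⟩
      · rw [← WithZero.exp_zero, WithZero.exp_le_exp]; exact zero_le_one
      · rw [map_sub]; linear_combination -hyσ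
    refine ⟨⟨_, hβmem⟩, ?_⟩
    rw [← hpα, QuotientGroup.eq, hd.mem_unitaryInt_iff_of_unitriangular_three (inv_mul_mem_upperUnitriangular_three (huU _) hpU),
      inv_mul_apply_zero_one_three hd.σσ (huU _) hpU, inv_mul_apply_zero_two_three hd.σσ (huU _) hpU, hu01, hu02]
    refine ⟨by rw [sub_zero]; exact hva, ?_⟩
    have : ((p : GL (Fin 3) K) : Matrix (Fin 3) (Fin 3) K) 0 2 + 0 * σ (((p : GL (Fin 3) K) : Matrix (Fin 3) (Fin 3) K) 0 1) +
        σ (((p : GL (Fin 3) K) : Matrix (Fin 3) (Fin 3) K) 0 2 - y) = y := by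
      rw [map_sub]; linear_combination -hyσ
    rw [this]; exact hyv
  -- (F4) counting through `L_1/L_0`
  set L0' : AddSubgroup L1 := L0.addSubgroupOf L1 with hL0'
  have hne : Nat.sqrt (Nat.card 𝓀[K]) ≠ 0 := (Nat.sqrt_pos.2 Nat.card_pos).ne'
  haveI hfin : Fintype (L1 ⧸ L0') := AddSubgroup.fintypeOfIndexNeZero (by
    show L0.relIndex L1 ≠ 0
    rw [hidx]; exact hne)
  let F : L1 ⧸ L0' → unitaryGroupOfForm σ ((StdForm.antidiagonal 3).over K) ⧸ unitaryInt σ ((StdForm.antidiagonal 3).over K) :=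
    Quotient.lift (s := QuotientAddGroup.leftRel L0')
      (fun β : L1 => ((u β : unitaryGroupOfForm σ ((StdForm.antidiagonal 3).over K)) :
        unitaryGroupOfForm σ ((StdForm.antidiagonal 3).over K) ⧸ unitaryInt σ ((StdForm.antidiagonal 3).over K))) fun β β' h => by
      have h' : -β + β' ∈ L0' := QuotientAddGroup.leftRel_apply.mp h
      rw [hL0', AddSubgroup.mem_addSubgroupOf, hmemL0] at h'
      show ((u β : unitaryGroupOfForm σ ((StdForm.antidiagonal 3).over K)) :
        unitaryGroupOfForm σ ((StdForm.antidiagonal 3).over K) ⧸ unitaryInt σ ((StdForm.antidiagonal 3).over K)) = (u β' : _)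
      rw [hF1]
      have hc : ((-β + β' : L1) : K) = (β' : K) - β := by rw [AddSubgroup.coe_add, AddSubgroup.coe_neg]; ring
      rw [← hc]; exact h'.1
  have hFmk : ∀ β : L1, F (β : L1 ⧸ L0') = ((u β : unitaryGroupOfForm σ ((StdForm.antidiagonal 3).over K)) :
      unitaryGroupOfForm σ ((StdForm.antidiagonal 3).over K) ⧸ unitaryInt σ ((StdForm.antidiagonal 3).over K)) := fun β => rfl
  have hFinj : Function.Injective F := by
    intro x y hxy
    obtain ⟨β, rfl⟩ := QuotientAddGroup.mk_surjective x
    obtain ⟨β', rfl⟩ := QuotientAddGroup.mk_surjective y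
    rw [hFmk, hFmk, hF1] at hxy
    refine QuotientAddGroup.eq.2 ?_
    rw [hL0', AddSubgroup.mem_addSubgroupOf, hmemL0]
    have hc : ((-β + β' : L1) : K) = (β' : K) - β := by rw [AddSubgroup.coe_add, AddSubgroup.coe_neg]; ring
    rw [hc]
    exact ⟨hxy, by rw [map_sub, hσβ, hσβ]; ring⟩
  have hnot : ((u 0 : unitaryGroupOfForm σ ((StdForm.antidiagonal 3).over K)) :
      unitaryGroupOfForm σ ((StdForm.antidiagonal 3).over K) ⧸ unitaryInt σ ((StdForm.antidiagonal 3).over K)) ∉ S := fun h =>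
    (hF2 0).1 h (by rw [ZeroMemClass.coe_zero, map_zero]; exact zero_le)
  have himage : Finset.univ.image F = insert ((u 0 : unitaryGroupOfForm σ ((StdForm.antidiagonal 3).over K)) :
      unitaryGroupOfForm σ ((StdForm.antidiagonal 3).over K) ⧸ unitaryInt σ ((StdForm.antidiagonal 3).over K)) S := by
    ext α
    rw [Finset.mem_image, Finset.mem_insert]
    constructor
    · rintro ⟨x, -, rfl⟩
      obtain ⟨β, rfl⟩ := QuotientAddGroup.mk_surjective x
      rw [hFmk]
      by_cases hβ : Valued.v (β : K) ≤ 1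
      · left
        rw [hF1, ZeroMemClass.coe_zero, zero_sub, Valuation.map_neg]
        exact hβ
      · right
        exact (hF2 β).2 hβ
    · rintro (rfl | hα)
      · exact ⟨((0 : L1) : L1 ⧸ L0'), Finset.mem_univ _, hFmk 0⟩
      · obtain ⟨β, hβ⟩ := hF3 α hα
        exact ⟨(β : L1 ⧸ L0'), Finset.mem_univ _, by rw [hFmk, hβ]⟩
  have hcard : (Finset.univ.image F).card = Nat.sqrt (Nat.card 𝓀[K]) := by
    rw [Finset.card_image_of_injective _ hFinj, Finset.card_univ, ← Nat.card_eq_fintype_card, ← AddSubgroup.index_eq_card]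
    exact hidx
  rw [himage, Finset.card_insert_of_notMem hnot] at hcard
  omega

/-- **`√Q` is an integer**: `residueCardSqrt K = Nat.sqrt #𝓀` when `σ ≠ id` (`#𝓀` is then a perfect square, g46-#1).
[cite: Serre1979, Ch. V §2] -/
theorem residueCardSqrt_eq_natCast_sqrt (hd : UnramifiedLocalConjDatum σ ϖ) (hσ : ∃ x : K, σ x ≠ x) [Finite 𝓀[K]] :
    residueCardSqrt K = (Nat.sqrt (Nat.card 𝓀[K]) : ℂ) := by
  have hsq := hd.sqrt_card_residueField_mul_self hσ
  have hR : (Nat.card 𝓀[K] : ℝ) = (Nat.sqrt (Nat.card 𝓀[K]) : ℝ) * Nat.sqrt (Nat.card 𝓀[K]) := by exact_mod_cast hsq.symm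
  rw [residueCardSqrt, hR, Real.sqrt_mul_self (Nat.cast_nonneg _), Complex.ofReal_natCast]

section Basic

variable [Finite 𝓀[K]]
  [IsHeckeTriple (⊤ : Submonoid (unitaryGroupOfForm σ ((StdForm.antidiagonal 3).over K))) (unitaryInt σ ((StdForm.antidiagonal 3).over K))
    (unitaryInt σ ((StdForm.antidiagonal 3).over K))]

/-- The line `ℓ_m = (m, 0, -m)` is injective in `m`. [folklore] -/
private theorem line_three_inj {a b : ℤ} : ((fun i : Fin 3 => a * (1 - (i : ℕ))) = fun i : Fin 3 => b * (1 - (i : ℕ))) ↔ a = b :=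
  ⟨fun h => by have := congrFun h 0; simpa using this, fun h => by rw [h]⟩

/-- **The bottom coefficient**: `𝒮(1_{K₀tK₀})_{ℓ₋₁} = Q` (one coset `tK₀` of exponent `ℓ₋₁ = (-1, 0, 1)`, weight `(√Q)² = Q`).
[cite: CartierCorvallis1979, §IV (4.2)] [cite: BruhatTits1972, (4.4.4) (ii)] -/
theorem coeff_satakeTransform_basic_neg_three (hd : UnramifiedLocalConjDatum σ ϖ) :
    (hd.satakeTransform (heckeAlgebra.doubleCosetOperator (unitaryInt σ ((StdForm.antidiagonal 3).over K))
        (⟨zpowDiagGL (uniformizer_ne_zero hd.vϖ) (fun i : Fin 3 => (1 : ℤ) * (1 - (i : ℕ))),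
          zpowDiagGL_mem_unitaryGroupOfForm hd.σϖ _ (rev_linear_three 1)⟩ : unitaryGroupOfForm σ ((StdForm.antidiagonal 3).over K)))).coeff
        (fun i : Fin 3 => (-1 : ℤ) * (1 - (i : ℕ))) = (Nat.card 𝓀[K] : ℂ) := by
  have hℓ : (fun i : Fin 3 => (-1 : ℤ) * (1 - (i : ℕ))) = fun i => -((fun i : Fin 3 => (1 : ℤ) * (1 - (i : ℕ))) i) :=
    funext fun i => by ring
  have hrev : ∀ i : Fin 3, (fun i : Fin 3 => -((1 : ℤ) * (1 - (i : ℕ)))) (Fin.rev i) = -(fun i : Fin 3 => -((1 : ℤ) * (1 - (i : ℕ)))) i :=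
    fun i => by
      have h := rev_linear_three 1 i
      simp only at h ⊢
      rw [h]
  rw [hd.satakeTransform_eq_isIwasawaExponent_satakeTransform, hℓ,
    hd.coeff_satakeTransform_doubleCosetOperator_neg _ ⟨antitone_linear_three 1 zero_le_one, rev_linear_three 1⟩, satakeWeightHom_ofAdd,
    satakeWeight, satakeTwistExp_eq_two_mul_three _ hrev]
  have he : -(2 * -((1 : ℤ) * (1 - (((0 : Fin 3) : ℕ) : ℤ)))) = 2 := by norm_num
  rw [he, zpow_two, ← sq, residueCardSqrt_sq]

/-- **The top coefficient**: `𝒮(1_{K₀tK₀})_{ℓ₁} = Q` (by the `W`-symmetry of `𝒮`, g46-#3; directly: `Q²` cosets of exponent `ℓ₁`,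
weight `Q⁻¹`). [cite: CartierCorvallis1979, §IV (4.2), Thm. 4.1] -/
theorem coeff_satakeTransform_basic_pos_three (hd : UnramifiedLocalConjDatum σ ϖ) (hσ : ∃ x : K, σ x ≠ x) :
    (hd.satakeTransform (heckeAlgebra.doubleCosetOperator (unitaryInt σ ((StdForm.antidiagonal 3).over K))
        (⟨zpowDiagGL (uniformizer_ne_zero hd.vϖ) (fun i : Fin 3 => (1 : ℤ) * (1 - (i : ℕ))),
          zpowDiagGL_mem_unitaryGroupOfForm hd.σϖ _ (rev_linear_three 1)⟩ : unitaryGroupOfForm σ ((StdForm.antidiagonal 3).over K)))).coeff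
        (fun i : Fin 3 => (1 : ℤ) * (1 - (i : ℕ))) = (Nat.card 𝓀[K] : ℂ) := by
  have hℓ : (-fun i : Fin 3 => (1 : ℤ) * (1 - (i : ℕ))) = fun i : Fin 3 => (-1 : ℤ) * (1 - (i : ℕ)) :=
    funext fun i => by simp only [Pi.neg_apply]; ring
  rw [← hd.coeff_satakeTransform_neg_three hσ, hℓ, hd.coeff_satakeTransform_basic_neg_three]

/-- **The middle coefficient**: `𝒮(1_{K₀tK₀})_0 = √Q - 1`. [cite: CartierCorvallis1979, §IV (4.2)] [cite: Serre1979, Ch. V §2] -/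
theorem coeff_satakeTransform_basic_zero_three (hd : UnramifiedLocalConjDatum σ ϖ) (hσ : ∃ x : K, σ x ≠ x) :
    (hd.satakeTransform (heckeAlgebra.doubleCosetOperator (unitaryInt σ ((StdForm.antidiagonal 3).over K))
        (⟨zpowDiagGL (uniformizer_ne_zero hd.vϖ) (fun i : Fin 3 => (1 : ℤ) * (1 - (i : ℕ))),
          zpowDiagGL_mem_unitaryGroupOfForm hd.σϖ _ (rev_linear_three 1)⟩ : unitaryGroupOfForm σ ((StdForm.antidiagonal 3).over K)))).coeff 0 =
      (Nat.sqrt (Nat.card 𝓀[K]) : ℂ) - 1 := by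
  classical
  have h1 : 1 ≤ Nat.sqrt (Nat.card 𝓀[K]) := Nat.sqrt_pos.2 Nat.card_pos
  rw [hd.coeff_satakeTransform_doubleCosetOperator, hd.card_filter_iwasawaExp_basic_zero_three hσ, satakeWeight, satakeTwistExp_zero,
    neg_zero, zpow_zero, mul_one, Nat.cast_sub h1, Nat.cast_one]

/-- **The support**: `𝒮(1_{K₀tK₀})_{ℓ_m} = 0` for `m ∉ {-1, 0, 1}` (head-sum bound `m ≥ -1` and `W`-symmetry).
[cite: CartierCorvallis1979, §IV (4.2), (4.4)] [cite: BruhatTits1972, (4.4.4) (i)] -/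
theorem coeff_satakeTransform_basic_eq_zero_three (hd : UnramifiedLocalConjDatum σ ϖ) (hσ : ∃ x : K, σ x ≠ x) {m : ℤ}
    (hm : m ≠ -1 ∧ m ≠ 0 ∧ m ≠ 1) :
    (hd.satakeTransform (heckeAlgebra.doubleCosetOperator (unitaryInt σ ((StdForm.antidiagonal 3).over K))
        (⟨zpowDiagGL (uniformizer_ne_zero hd.vϖ) (fun i : Fin 3 => (1 : ℤ) * (1 - (i : ℕ))),
          zpowDiagGL_mem_unitaryGroupOfForm hd.σϖ _ (rev_linear_three 1)⟩ : unitaryGroupOfForm σ ((StdForm.antidiagonal 3).over K)))).coeff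
        (fun i : Fin 3 => m * (1 - (i : ℕ))) = 0 := by
  -- head-sum bound: a non-zero coefficient at `ℓ_n` forces `-1 ≤ n`
  have hbound : ∀ n : ℤ, (hd.satakeTransform (heckeAlgebra.doubleCosetOperator (unitaryInt σ ((StdForm.antidiagonal 3).over K))
      (⟨zpowDiagGL (uniformizer_ne_zero hd.vϖ) (fun i : Fin 3 => (1 : ℤ) * (1 - (i : ℕ))),
        zpowDiagGL_mem_unitaryGroupOfForm hd.σϖ _ (rev_linear_three 1)⟩ : unitaryGroupOfForm σ ((StdForm.antidiagonal 3).over K)))).coeff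
        (fun i : Fin 3 => n * (1 - (i : ℕ))) ≠ 0 → -1 ≤ n := fun n hn => by
    rw [hd.satakeTransform_eq_isIwasawaExponent_satakeTransform] at hn
    have h := hd.forall_sum_ite_lt_neg_le_of_coeff_satakeTransform_ne_zero _ ⟨antitone_linear_three 1 zero_le_one, rev_linear_three 1⟩ hn 1
    simp at h
    linarith
  by_contra hne
  have h1 := hbound m hne
  have hℓ : (-fun i : Fin 3 => m * (1 - (i : ℕ))) = fun i : Fin 3 => (-m) * (1 - (i : ℕ)) :=
    funext fun i => by simp only [Pi.neg_apply]; ring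
  rw [← hd.coeff_satakeTransform_neg_three hσ, hℓ] at hne
  have h2 := hbound (-m) hne
  omega

/-- Coefficients of a scalar: `(c · 1)_μ = c` for `μ = 0` and `0` otherwise. [folklore] -/
private theorem coeff_algebraMap_three (c : ℂ) (μ : Fin 3 → ℤ) :
    (algebraMap ℂ (AddMonoidAlgebra ℂ (Fin 3 → ℤ)) c).coeff μ = if (0 : Fin 3 → ℤ) = μ then c else 0 := by
  rw [Algebra.algebraMap_eq_smul_one, AddMonoidAlgebra.one_def, AddMonoidAlgebra.coeff_smul, Finsupp.smul_apply,
    AddMonoidAlgebra.coeff_single, Finsupp.single_apply, smul_eq_mul, mul_ite, mul_one, mul_zero]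

/-- **THE BASIC HECKE OPERATOR OF `U(3)` EVALUATED**: for `t = diag(ϖ, 1, ϖ⁻¹)` and `Q = #𝓀 = q_F²`,
`𝒮(1_{K₀tK₀}) = Q · (x^{(1,0,-1)} + x^{(-1,0,1)}) + (√Q - 1) · 1` — Cartier's `Sf(t_μ) = δ^{½}(t_μ) · #{…}` computed on the
bi-regular tree of `U(3)`: one coset above, `√Q - 1 = q_F - 1` level, `Q² = q_F⁴` below. [cite: CartierCorvallis1979, §IV (4.2), Thm. 4.1]
[cite: Rogawski1990, §4.5 p. 50] [cite: Satake1963, §§6–7] -/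
theorem satakeTransform_doubleCosetOperator_basic_three (hd : UnramifiedLocalConjDatum σ ϖ) (hσ : ∃ x : K, σ x ≠ x) :
    hd.satakeTransform (heckeAlgebra.doubleCosetOperator (unitaryInt σ ((StdForm.antidiagonal 3).over K))
        (⟨zpowDiagGL (uniformizer_ne_zero hd.vϖ) (fun i : Fin 3 => (1 : ℤ) * (1 - (i : ℕ))),
          zpowDiagGL_mem_unitaryGroupOfForm hd.σϖ _ (rev_linear_three 1)⟩ : unitaryGroupOfForm σ ((StdForm.antidiagonal 3).over K))) =
      (Nat.card 𝓀[K] : ℂ) • (AddMonoidAlgebra.single (fun i : Fin 3 => (1 : ℤ) * (1 - (i : ℕ))) (1 : ℂ) +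
          AddMonoidAlgebra.single (fun i : Fin 3 => (-1 : ℤ) * (1 - (i : ℕ))) 1) +
        algebraMap ℂ (AddMonoidAlgebra ℂ (Fin 3 → ℤ)) ((Nat.sqrt (Nat.card 𝓀[K]) : ℂ) - 1) := by
  classical
  refine AddMonoidAlgebra.ext (Finsupp.ext fun μ => ?_)
  rw [AddMonoidAlgebra.coeff_add, Finsupp.add_apply, AddMonoidAlgebra.coeff_smul, Finsupp.smul_apply, AddMonoidAlgebra.coeff_add,
    Finsupp.add_apply, AddMonoidAlgebra.coeff_single, AddMonoidAlgebra.coeff_single, Finsupp.single_apply, Finsupp.single_apply,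
    coeff_algebraMap_three, smul_eq_mul]
  by_cases hμ : ∀ i, μ (Fin.rev i) = -μ i
  · obtain ⟨m, hm⟩ : ∃ m : ℤ, μ = fun i : Fin 3 => m * (1 - (i : ℕ)) := ⟨μ 0, eq_linear_three_of_rev μ hμ⟩
    subst hm
    have h0 : (0 : Fin 3 → ℤ) = fun i : Fin 3 => (0 : ℤ) * (1 - (i : ℕ)) := funext fun i => by simp
    rw [h0]
    simp only [line_three_inj]
    by_cases h1 : m = 1
    · subst h1
      rw [if_pos rfl, if_neg (by norm_num), if_neg (by norm_num), hd.coeff_satakeTransform_basic_pos_three hσ]; ring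
    by_cases h2 : m = -1
    · subst h2
      rw [if_neg (by norm_num), if_pos rfl, if_neg (by norm_num), hd.coeff_satakeTransform_basic_neg_three]; ring
    by_cases h3 : m = 0
    · subst h3
      rw [if_neg (by norm_num), if_neg (by norm_num), if_pos rfl, ← h0, hd.coeff_satakeTransform_basic_zero_three hσ]; ring
    · rw [if_neg (Ne.symm h1), if_neg (Ne.symm h2), if_neg (Ne.symm h3), hd.coeff_satakeTransform_basic_eq_zero_three hσ ⟨h2, h3, h1⟩]
      ring
  · have hne : ∀ a : ℤ, (fun i : Fin 3 => a * (1 - (i : ℕ))) ≠ μ := fun a h => hμ (h ▸ rev_linear_three a)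
    have hne0 : (0 : Fin 3 → ℤ) ≠ μ := fun h => hμ (fun i => by rw [← h, Pi.zero_apply, Pi.zero_apply, neg_zero])
    rw [hd.satakeTransform_eq_isIwasawaExponent_satakeTransform, hd.coeff_satakeTransform_eq_zero_of_not_rev _ _ hμ,
      if_neg (hne 1), if_neg (hne (-1)), if_neg hne0]
    ring

/-! ## §4 Consequences: Hecke eigenvalues, `ℋ(U(3), K₀) = ℂ[1_{K₀tK₀}]` -/

/-- **THE HECKE EIGENVALUES OF THE BASIC OPERATOR**: `λ_β(1_{K₀tK₀}) = Q(z + z⁻¹) + √Q - 1`, `z = β₀β₂⁻¹` the Satake parameter.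
[cite: CartierCorvallis1979, §IV (4.2), Cor. 4.2] [cite: Rogawski1990, §4.5 p. 50] -/
theorem heckeEigencharacter_doubleCosetOperator_basic_three (hd : UnramifiedLocalConjDatum σ ϖ) (hσ : ∃ x : K, σ x ≠ x) (β : Fin 3 → ℂˣ) :
    hd.heckeEigencharacter β (heckeAlgebra.doubleCosetOperator (unitaryInt σ ((StdForm.antidiagonal 3).over K))
        (⟨zpowDiagGL (uniformizer_ne_zero hd.vϖ) (fun i : Fin 3 => (1 : ℤ) * (1 - (i : ℕ))),
          zpowDiagGL_mem_unitaryGroupOfForm hd.σϖ _ (rev_linear_three 1)⟩ : unitaryGroupOfForm σ ((StdForm.antidiagonal 3).over K))) =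
      (Nat.card 𝓀[K] : ℂ) * ((β 0 : ℂ) * (β 2 : ℂ)⁻¹ + ((β 0 : ℂ) * (β 2 : ℂ)⁻¹)⁻¹) + ((Nat.sqrt (Nat.card 𝓀[K]) : ℂ) - 1) := by
  have hz : ∀ e : ℤ, (∏ i : Fin 3, ((β i : ℂ) ^ (e * (1 - ((i : ℕ) : ℤ))))) = ((β 0 : ℂ) * (β 2 : ℂ)⁻¹) ^ e := fun e => by
    rw [Fin.prod_univ_three]
    simp only [Fin.val_zero, Fin.val_one, Fin.val_two, Nat.cast_zero, Nat.cast_one, Nat.cast_ofNat, sub_zero, sub_self, mul_one,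
      mul_zero, zpow_zero, show (1 : ℤ) - 2 = -1 by norm_num, mul_neg, zpow_neg, mul_zpow, inv_zpow]
  rw [hd.heckeEigencharacter_apply, hd.satakeTransform_doubleCosetOperator_basic_three hσ, map_add, map_smul, AlgHom.commutes,
    Algebra.algebraMap_self_apply, map_add, laurentEvalAt_single, laurentEvalAt_single, one_mul, one_mul, hz, hz, zpow_one,
    zpow_neg, zpow_one, smul_eq_mul]

/-- **Every complex number is a Hecke eigenvalue of the basic operator**: for every `c₀ ∈ ℂ` there is a torus parameter `β` with
`λ_β(1_{K₀tK₀}) = c₀`. [cite: CartierCorvallis1979, §IV Cor. 4.2] -/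
theorem exists_heckeEigencharacter_doubleCosetOperator_eq_three (hd : UnramifiedLocalConjDatum σ ϖ) (hσ : ∃ x : K, σ x ≠ x) (c₀ : ℂ) :
    ∃ β : Fin 3 → ℂˣ, hd.heckeEigencharacter β (heckeAlgebra.doubleCosetOperator (unitaryInt σ ((StdForm.antidiagonal 3).over K))
        (⟨zpowDiagGL (uniformizer_ne_zero hd.vϖ) (fun i : Fin 3 => (1 : ℤ) * (1 - (i : ℕ))),
          zpowDiagGL_mem_unitaryGroupOfForm hd.σϖ _ (rev_linear_three 1)⟩ : unitaryGroupOfForm σ ((StdForm.antidiagonal 3).over K))) = c₀ := by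
  have hQ : (Nat.card 𝓀[K] : ℂ) ≠ 0 := Nat.cast_ne_zero.2 Nat.card_pos.ne'
  obtain ⟨z, hz⟩ := exists_units_add_inv_eq ((c₀ - ((Nat.sqrt (Nat.card 𝓀[K]) : ℂ) - 1)) / Nat.card 𝓀[K])
  refine ⟨fun i => if i = 0 then z else 1, ?_⟩
  rw [hd.heckeEigencharacter_doubleCosetOperator_basic_three hσ, if_pos rfl, if_neg (by decide), Units.val_one, inv_one, mul_one, hz]
  field_simp
  ring

set_option synthInstance.maxHeartbeats 200000 in
/-- **`1_{K₀tK₀} = Q · T₁ + (√Q - 1)`** for the generator `T₁` of g46-#5 (`𝒮(T₁) = x^{ℓ₁} + x^{ℓ₋₁}`).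
[cite: CartierCorvallis1979, §IV Thm. 4.1] -/
theorem doubleCosetOperator_basic_eq_three (hd : UnramifiedLocalConjDatum σ ϖ) (hσ : ∃ x : K, σ x ≠ x)
    {T₁ : heckeAlgebra ℂ (unitaryGroupOfForm σ ((StdForm.antidiagonal 3).over K)) (unitaryInt σ ((StdForm.antidiagonal 3).over K))}
    (hT₁ : hd.satakeTransform T₁ = AddMonoidAlgebra.single (fun i : Fin 3 => (1 : ℤ) * (1 - (i : ℕ))) (1 : ℂ) +
      AddMonoidAlgebra.single (fun i : Fin 3 => (-1 : ℤ) * (1 - (i : ℕ))) 1) :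
    heckeAlgebra.doubleCosetOperator (unitaryInt σ ((StdForm.antidiagonal 3).over K))
        (⟨zpowDiagGL (uniformizer_ne_zero hd.vϖ) (fun i : Fin 3 => (1 : ℤ) * (1 - (i : ℕ))),
          zpowDiagGL_mem_unitaryGroupOfForm hd.σϖ _ (rev_linear_three 1)⟩ : unitaryGroupOfForm σ ((StdForm.antidiagonal 3).over K)) =
      (Nat.card 𝓀[K] : ℂ) • T₁ + algebraMap ℂ _ ((Nat.sqrt (Nat.card 𝓀[K]) : ℂ) - 1) :=
  hd.satakeTransform_injective (by
    rw [hd.satakeTransform_doubleCosetOperator_basic_three hσ, Algebra.smul_def, Algebra.smul_def]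
    simp only [map_add, map_mul, AlgHom.commutes, hT₁])

/-- **`ℋ(U(3), K₀) = ℂ[1_{K₀tK₀}]`**: every Hecke operator is a polynomial in the basic one (`T₁ = Q⁻¹(1_{K₀tK₀} - (√Q - 1))` and
g46-#5). [cite: CartierCorvallis1979, §IV Thm. 4.1, Cor. 4.2] [cite: Satake1963, §§6–7] -/
theorem exists_aeval_doubleCosetOperator_basic_three (hd : UnramifiedLocalConjDatum σ ϖ) (hσ : ∃ x : K, σ x ≠ x)
    (T : heckeAlgebra ℂ (unitaryGroupOfForm σ ((StdForm.antidiagonal 3).over K)) (unitaryInt σ ((StdForm.antidiagonal 3).over K))) :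
    ∃ P : ℂ[X], aeval (heckeAlgebra.doubleCosetOperator (k := ℂ) (unitaryInt σ ((StdForm.antidiagonal 3).over K))
        (⟨zpowDiagGL (uniformizer_ne_zero hd.vϖ) (fun i : Fin 3 => (1 : ℤ) * (1 - (i : ℕ))),
          zpowDiagGL_mem_unitaryGroupOfForm hd.σϖ _ (rev_linear_three 1)⟩ : unitaryGroupOfForm σ ((StdForm.antidiagonal 3).over K))) P = T := by
  obtain ⟨T₁, hT₁, hgen⟩ := hd.exists_generator_three hσ
  have hQ : (Nat.card 𝓀[K] : ℂ) ≠ 0 := Nat.cast_ne_zero.2 Nat.card_pos.ne'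
  have hc := hd.doubleCosetOperator_basic_eq_three hσ hT₁
  set c := heckeAlgebra.doubleCosetOperator (k := ℂ) (unitaryInt σ ((StdForm.antidiagonal 3).over K))
    (⟨zpowDiagGL (uniformizer_ne_zero hd.vϖ) (fun i : Fin 3 => (1 : ℤ) * (1 - (i : ℕ))),
      zpowDiagGL_mem_unitaryGroupOfForm hd.σϖ _ (rev_linear_three 1)⟩ : unitaryGroupOfForm σ ((StdForm.antidiagonal 3).over K)) with hcdef
  have h2 : aeval c (X - C ((Nat.sqrt (Nat.card 𝓀[K]) : ℂ) - 1)) = (Nat.card 𝓀[K] : ℂ) • T₁ := by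
    rw [map_sub, aeval_X, aeval_C]
    exact sub_eq_of_eq_add hc
  have hT₁c : T₁ = aeval c (C (Nat.card 𝓀[K] : ℂ)⁻¹ * (X - C ((Nat.sqrt (Nat.card 𝓀[K]) : ℂ) - 1))) := by
    rw [map_mul, aeval_C, h2, Algebra.algebraMap_eq_smul_one, smul_mul_assoc, one_mul, smul_smul, inv_mul_cancel₀ hQ, one_smul]
  obtain ⟨P, hP⟩ := hgen T
  exact ⟨P.comp (C (Nat.card 𝓀[K] : ℂ)⁻¹ * (X - C ((Nat.sqrt (Nat.card 𝓀[K]) : ℂ) - 1))), by rw [aeval_comp, ← hT₁c, hP]⟩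

/-- **An unramified character of `ℋ(U(3), K₀)` is determined by its value on the basic Hecke operator.**
[cite: CartierCorvallis1979, §IV Cor. 4.2] [cite: Rogawski1990, §4.5 p. 50] -/
theorem algHom_ext_doubleCosetOperator_basic_three (hd : UnramifiedLocalConjDatum σ ϖ) (hσ : ∃ x : K, σ x ≠ x) {B : Type*} [Semiring B]
    [Algebra ℂ B]
    {χ χ' : heckeAlgebra ℂ (unitaryGroupOfForm σ ((StdForm.antidiagonal 3).over K)) (unitaryInt σ ((StdForm.antidiagonal 3).over K)) →ₐ[ℂ] B}
    (h : χ (heckeAlgebra.doubleCosetOperator (unitaryInt σ ((StdForm.antidiagonal 3).over K))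
        (⟨zpowDiagGL (uniformizer_ne_zero hd.vϖ) (fun i : Fin 3 => (1 : ℤ) * (1 - (i : ℕ))),
          zpowDiagGL_mem_unitaryGroupOfForm hd.σϖ _ (rev_linear_three 1)⟩ : unitaryGroupOfForm σ ((StdForm.antidiagonal 3).over K))) =
      χ' (heckeAlgebra.doubleCosetOperator (unitaryInt σ ((StdForm.antidiagonal 3).over K))
        (⟨zpowDiagGL (uniformizer_ne_zero hd.vϖ) (fun i : Fin 3 => (1 : ℤ) * (1 - (i : ℕ))),
          zpowDiagGL_mem_unitaryGroupOfForm hd.σϖ _ (rev_linear_three 1)⟩ : unitaryGroupOfForm σ ((StdForm.antidiagonal 3).over K)))) :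
    χ = χ' := by
  refine AlgHom.ext fun T => ?_
  obtain ⟨P, rfl⟩ := hd.exists_aeval_doubleCosetOperator_basic_three hσ T
  rw [← aeval_algHom_apply, ← aeval_algHom_apply, h]

/-- **THE DEGREE OF THE BASIC HECKE OPERATOR OF `U(3)`**: `#(K₀tK₀/K₀) = Q² + √Q` (`= q_F⁴ + q_F`, the hyperspecial vertices at
distance `2` in the bi-regular tree; the eigenvalue `λ_{β₀}(1_{K₀tK₀})` at the trivial point `z = Q`).
[cite: CartierCorvallis1979, §IV (4.2)–(4.4)] [cite: ShimuraIATAF1971, §3.1 Prop. 3.3] -/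
theorem card_orbit_basic_three (hd : UnramifiedLocalConjDatum σ ϖ) (hσ : ∃ x : K, σ x ≠ x) :
    (finite_orbit_quotient (unitaryInt σ ((StdForm.antidiagonal 3).over K))
        (⟨zpowDiagGL (uniformizer_ne_zero hd.vϖ) (fun i : Fin 3 => (1 : ℤ) * (1 - (i : ℕ))),
          zpowDiagGL_mem_unitaryGroupOfForm hd.σϖ _ (rev_linear_three 1)⟩ : unitaryGroupOfForm σ ((StdForm.antidiagonal 3).over K))).toFinset.card =
      Nat.card 𝓀[K] ^ 2 + Nat.sqrt (Nat.card 𝓀[K]) := by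
  have hQ : (Nat.card 𝓀[K] : ℂ) ≠ 0 := Nat.cast_ne_zero.2 Nat.card_pos.ne'
  have h := hd.heckeEigencharacter_trivialPoint_doubleCosetOperator (N := 3)
    (⟨zpowDiagGL (uniformizer_ne_zero hd.vϖ) (fun i : Fin 3 => (1 : ℤ) * (1 - (i : ℕ))),
      zpowDiagGL_mem_unitaryGroupOfForm hd.σϖ _ (rev_linear_three 1)⟩ : unitaryGroupOfForm σ ((StdForm.antidiagonal 3).over K))
  rw [hd.heckeEigencharacter_doubleCosetOperator_basic_three hσ] at h
  simp only [Units.val_mk0] at h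
  have e0 : (((3 : ℕ) : ℤ) - 1 - (((0 : Fin 3) : ℕ) : ℤ)) = 2 := by norm_num
  have e2 : (((3 : ℕ) : ℤ) - 1 - (((2 : Fin 3) : ℕ) : ℤ)) = 0 := by norm_num
  rw [e0, e2, zpow_zero, inv_one, mul_one, zpow_two, ← sq, residueCardSqrt_sq] at h
  have h' : ((Nat.card 𝓀[K] : ℂ)) ^ 2 + (Nat.sqrt (Nat.card 𝓀[K]) : ℂ) =
      ((finite_orbit_quotient (unitaryInt σ ((StdForm.antidiagonal 3).over K))
        (⟨zpowDiagGL (uniformizer_ne_zero hd.vϖ) (fun i : Fin 3 => (1 : ℤ) * (1 - (i : ℕ))),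
          zpowDiagGL_mem_unitaryGroupOfForm hd.σϖ _ (rev_linear_three 1)⟩ : unitaryGroupOfForm σ ((StdForm.antidiagonal 3).over K))).toFinset.card : ℂ) := by
    rw [← h]; field_simp; ring
  exact_mod_cast h'.symm

/-- **`P ↦ P(1_{K₀tK₀})` is injective** (`U(3)`): the basic Hecke operator is transcendental over `ℂ` — every complex number is an
eigenvalue `λ_β(1_{K₀tK₀})`, so `P(1_{K₀tK₀}) = 0` forces `P(c₀) = 0` for all `c₀`. [cite: CartierCorvallis1979, §IV Thm. 4.1, Cor. 4.2] -/
theorem aeval_doubleCosetOperator_basic_injective_three (hd : UnramifiedLocalConjDatum σ ϖ) (hσ : ∃ x : K, σ x ≠ x) :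
    Function.Injective (aeval (R := ℂ) (heckeAlgebra.doubleCosetOperator (k := ℂ) (unitaryInt σ ((StdForm.antidiagonal 3).over K))
        (⟨zpowDiagGL (uniformizer_ne_zero hd.vϖ) (fun i : Fin 3 => (1 : ℤ) * (1 - (i : ℕ))),
          zpowDiagGL_mem_unitaryGroupOfForm hd.σϖ _ (rev_linear_three 1)⟩ : unitaryGroupOfForm σ ((StdForm.antidiagonal 3).over K)))) := by
  refine (injective_iff_map_eq_zero _).2 fun P hP => Polynomial.funext fun c₀ => ?_
  obtain ⟨β, hβ⟩ := hd.exists_heckeEigencharacter_doubleCosetOperator_eq_three hσ c₀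
  have h := congrArg (hd.heckeEigencharacter β) hP
  rw [← aeval_algHom_apply, hβ, map_zero, coe_aeval_eq_eval] at h
  rw [h, eval_zero]

/-- **`ℋ(U(3), K₀) ≅ ℂ[X]`, `X ↦ 1_{K₀tK₀}`**: the spherical Hecke algebra of the unramified `U(3)` is the polynomial algebra in its
basic Hecke operator (Cartier's Theorem 4.1 in rank one: `ℋ(G, K) ≅ ℂ[Λ]^W = ℂ[x + x⁻¹]`). [cite: CartierCorvallis1979, §IV Thm. 4.1]
[cite: Satake1963, §§6–7] -/
theorem exists_algEquiv_polynomial_basic_three (hd : UnramifiedLocalConjDatum σ ϖ) (hσ : ∃ x : K, σ x ≠ x) :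
    ∃ e : ℂ[X] ≃ₐ[ℂ] heckeAlgebra ℂ (unitaryGroupOfForm σ ((StdForm.antidiagonal 3).over K)) (unitaryInt σ ((StdForm.antidiagonal 3).over K)),
      e X = heckeAlgebra.doubleCosetOperator (unitaryInt σ ((StdForm.antidiagonal 3).over K))
        (⟨zpowDiagGL (uniformizer_ne_zero hd.vϖ) (fun i : Fin 3 => (1 : ℤ) * (1 - (i : ℕ))),
          zpowDiagGL_mem_unitaryGroupOfForm hd.σϖ _ (rev_linear_three 1)⟩ : unitaryGroupOfForm σ ((StdForm.antidiagonal 3).over K)) :=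
  ⟨AlgEquiv.ofBijective _ ⟨hd.aeval_doubleCosetOperator_basic_injective_three hσ, fun T =>
    hd.exists_aeval_doubleCosetOperator_basic_three hσ T⟩, by rw [AlgEquiv.ofBijective_apply, aeval_X]⟩

end Basic

end UnramifiedLocalConjDatum

/-! ## §5 `U(2)`: `𝒮(1_{K₀tK₀}) = √Q·(x^{(1,-1)} + x^{(-1,1)}) + (√Q - 1)`, `t = diag(ϖ, ϖ⁻¹)` -/

omit [Valued K ℤᵐ⁰] in
/-- `g⁻¹h` is upper unitriangular for `g, h` upper unitriangular (`N = 2`). [folklore] -/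
private theorem inv_mul_mem_upperUnitriangular_two {g h : unitaryGroupOfForm σ ((StdForm.antidiagonal 2).over K)}
    (hg : (g : GL (Fin 2) K) ∈ upperUnitriangular (Fin 2) K) (hh : (h : GL (Fin 2) K) ∈ upperUnitriangular (Fin 2) K) :
    ((g⁻¹ * h : unitaryGroupOfForm σ ((StdForm.antidiagonal 2).over K)) : GL (Fin 2) K) ∈ upperUnitriangular (Fin 2) K := by
  rw [Subgroup.coe_mul, Subgroup.coe_inv]
  exact (upperUnitriangular (Fin 2) K).mul_mem ((upperUnitriangular (Fin 2) K).inv_mem hg) hh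

omit [Valued K ℤᵐ⁰] in
/-- **The group law of `N(K) ≤ U(2)`**: `(u(β)⁻¹ u(β'))₀₁ = β' + σβ` (`= β' - β`). [cite: Rogawski1990, §1.10 p. 14] -/
theorem inv_mul_apply_zero_one_two {g h : unitaryGroupOfForm σ ((StdForm.antidiagonal 2).over K)}
    (hg : (g : GL (Fin 2) K) ∈ upperUnitriangular (Fin 2) K) (hh : (h : GL (Fin 2) K) ∈ upperUnitriangular (Fin 2) K) :
    (((g⁻¹ * h : unitaryGroupOfForm σ ((StdForm.antidiagonal 2).over K)) : GL (Fin 2) K) : Matrix (Fin 2) (Fin 2) K) 0 1 =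
      ((h : GL (Fin 2) K) : Matrix (Fin 2) (Fin 2) K) 0 1 + σ (((g : GL (Fin 2) K) : Matrix (Fin 2) (Fin 2) K) 0 1) := by
  rw [Subgroup.coe_mul, Units.val_mul, Matrix.mul_apply, Fin.sum_univ_two]
  simp only [coe_inv_apply_unitary, show Fin.rev (0 : Fin 2) = 1 from by decide, show Fin.rev (1 : Fin 2) = 0 from by decide]
  rw [apply_self_of_mem_upperUnitriangular hg, apply_self_of_mem_upperUnitriangular hh, map_one]
  ring

/-- The entries of a unitriangular `u(β) ∈ U(2)` have `v ≤ |ϖ^{-γ}|` (`γ ≥ 0`) iff `v β ≤ |ϖ^{-γ}|`. [cite: Rogawski1990, §1.10 p. 14] -/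
theorem forall_v_apply_le_iff_of_unitriangular_two {u : unitaryGroupOfForm σ ((StdForm.antidiagonal 2).over K)}
    (hu : (u : GL (Fin 2) K) ∈ upperUnitriangular (Fin 2) K) {γ : ℤ} (hγ : 0 ≤ γ) :
    (∀ i j, Valued.v (((u : GL (Fin 2) K) : Matrix (Fin 2) (Fin 2) K) i j) ≤ WithZero.exp γ) ↔
      Valued.v (((u : GL (Fin 2) K) : Matrix (Fin 2) (Fin 2) K) 0 1) ≤ WithZero.exp γ := by
  have hT := blockTriangular_of_mem_upperUnitriangular hu
  have h1 : (1 : ℤᵐ⁰) ≤ WithZero.exp γ := by rw [← WithZero.exp_zero, WithZero.exp_le_exp]; exact hγ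
  refine ⟨fun h => h 0 1, fun h i j => ?_⟩
  fin_cases i <;> fin_cases j
  · rw [apply_self_of_mem_upperUnitriangular hu, map_one]; exact h1
  · exact h
  · rw [hT (by decide), map_zero]; exact zero_le
  · rw [apply_self_of_mem_upperUnitriangular hu, map_one]; exact h1

namespace UnramifiedLocalConjDatum

/-- A unitriangular `w = u(β) ∈ U(2)` lies in `K₀` iff `v β ≤ 1`. [cite: Rogawski1990, §1.10 p. 14] -/
theorem mem_unitaryInt_iff_of_unitriangular_two (hd : UnramifiedLocalConjDatum σ ϖ)
    {w : unitaryGroupOfForm σ ((StdForm.antidiagonal 2).over K)} (hw : (w : GL (Fin 2) K) ∈ upperUnitriangular (Fin 2) K) :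
    w ∈ unitaryInt σ ((StdForm.antidiagonal 2).over K) ↔ Valued.v (((w : GL (Fin 2) K) : Matrix (Fin 2) (Fin 2) K) 0 1) ≤ 1 := by
  have h1 := hd.mem_borelLatticeU_inf_unitaryInt_iff (x := w)
  have h2 := hd.mem_borelInt_iff_two (g := w)
  exact ⟨fun hw0 => (h2.1 (h1.2 ⟨hw, hw0⟩)).2, fun hv => (h1.1 (h2.2 ⟨hw, hv⟩)).2⟩

/-- **The double coset of a unipotent element of `U(2)`**: a unitriangular `u(β)` lies in `K₀ t K₀`, `t = diag(ϖ, ϖ⁻¹)`, iff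
`v β = |ϖ⁻¹|`. [cite: BruhatTits1972, (4.4.3)] [cite: Rogawski1990, §1.10 p. 14] -/
theorem coe_mem_orbit_basic_iff_two (hd : UnramifiedLocalConjDatum σ ϖ)
    {u : unitaryGroupOfForm σ ((StdForm.antidiagonal 2).over K)} (hu : (u : GL (Fin 2) K) ∈ upperUnitriangular (Fin 2) K) :
    (u : unitaryGroupOfForm σ ((StdForm.antidiagonal 2).over K) ⧸ unitaryInt σ ((StdForm.antidiagonal 2).over K)) ∈
        MulAction.orbit (unitaryInt σ ((StdForm.antidiagonal 2).over K))
          ((⟨zpowDiagGL (uniformizer_ne_zero hd.vϖ) (fun i : Fin 2 => (1 : ℤ) * (1 - 2 * (i : ℕ))),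
              zpowDiagGL_mem_unitaryGroupOfForm hd.σϖ _ (rev_linear_two 1)⟩ : unitaryGroupOfForm σ ((StdForm.antidiagonal 2).over K)) :
            unitaryGroupOfForm σ ((StdForm.antidiagonal 2).over K) ⧸ unitaryInt σ ((StdForm.antidiagonal 2).over K)) ↔
      Valued.v (((u : GL (Fin 2) K) : Matrix (Fin 2) (Fin 2) K) 0 1) ≤ WithZero.exp 1 ∧
        ¬ Valued.v (((u : GL (Fin 2) K) : Matrix (Fin 2) (Fin 2) K) 0 1) ≤ 1 := by
  have hϖ0 := uniformizer_ne_zero hd.vϖ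
  have hdiag : ∀ (a : Fin 2 → ℤ) (ha : ∀ i, a (Fin.rev i) = -a i) (γ : ℤ),
      (∀ i j, Valued.v ((((⟨zpowDiagGL hϖ0 a, zpowDiagGL_mem_unitaryGroupOfForm hd.σϖ _ ha⟩ :
          unitaryGroupOfForm σ ((StdForm.antidiagonal 2).over K)) : GL (Fin 2) K) : Matrix (Fin 2) (Fin 2) K) i j) ≤ WithZero.exp γ) ↔
        ∀ i, -a i ≤ γ := fun a ha γ => forall_v_zpowDiagGL_apply_le_iff hd.vϖ a γ
  have h01 : (0 : ℤ) ≤ 1 := zero_le_one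
  constructor
  · intro hmem
    obtain ⟨a, ha, b, hb, hab⟩ := (heckeAlgebra.coe_mem_orbit_coe_iff (unitaryInt σ ((StdForm.antidiagonal 2).over K)) _ u).1 hmem
    have key : ∀ γ : ℤ, 0 ≤ γ →
        (Valued.v (((u : GL (Fin 2) K) : Matrix (Fin 2) (Fin 2) K) 0 1) ≤ WithZero.exp γ ↔ ∀ i : Fin 2, -((1 : ℤ) * (1 - 2 * (i : ℕ))) ≤ γ) :=
      fun γ hγ => by
        rw [← forall_v_apply_le_iff_of_unitriangular_two hu hγ, forall_v_apply_le_iff_of_eq_mul_mul hd.vσ ha hb hab, hdiag _ (rev_linear_two 1)]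
    have h1 := (key 1 h01).2 fun i => by fin_cases i <;> simp
    have h0 : ¬ Valued.v (((u : GL (Fin 2) K) : Matrix (Fin 2) (Fin 2) K) 0 1) ≤ 1 := fun h => by
      have := (key 0 le_rfl).1 (by rw [WithZero.exp_zero]; exact h) 1
      simp at this
    exact ⟨h1, h0⟩
  · rintro ⟨hβ, hβ'⟩
    obtain ⟨a, ha, hmk⟩ := heckeCosetMk_zpowDiagGL_eq_of_unitary hd u
    obtain ⟨k₁, hk₁, k₂, hk₂, hu'⟩ := (heckeAlgebra.heckeCosetMk_eq_iff (unitaryInt σ ((StdForm.antidiagonal 2).over K)) _ _).1 hmk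
    have key : ∀ γ : ℤ, 0 ≤ γ →
        (Valued.v (((u : GL (Fin 2) K) : Matrix (Fin 2) (Fin 2) K) 0 1) ≤ WithZero.exp γ ↔ ∀ i : Fin 2, -a i ≤ γ) := fun γ hγ => by
      rw [← forall_v_apply_le_iff_of_unitriangular_two hu hγ, forall_v_apply_le_iff_of_eq_mul_mul hd.vσ hk₁ hk₂ hu', hdiag _ ha.2]
    have h1 : ∀ i, -a i ≤ 1 := (key 1 h01).1 hβ
    have h0 : ¬ ∀ i, -a i ≤ 0 := fun h => hβ' (by
      have := (key 0 le_rfl).2 h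
      rwa [WithZero.exp_zero] at this)
    have hlin := eq_linear_two_of_rev a ha.2
    have ha1 : a 1 = -a 0 := by
      have := congrFun hlin 1
      simp only [Fin.isValue, Fin.val_one, Nat.cast_one] at this
      linear_combination this
    have hmono : a 1 ≤ a 0 := ha.1 (show (0 : Fin 2) ≤ 1 by decide)
    have ha0 : a 0 = 1 := by
      have h11 := h1 1
      by_contra hne
      refine h0 fun i => ?_
      fin_cases i
      · show -a 0 ≤ 0; omega
      · show -a 1 ≤ 0; omega
    have haℓ : a = fun i : Fin 2 => (1 : ℤ) * (1 - 2 * (i : ℕ)) := by rw [hlin, ha0]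
    subst haℓ
    exact (heckeAlgebra.coe_mem_orbit_coe_iff (unitaryInt σ ((StdForm.antidiagonal 2).over K)) _ u).2 ⟨k₁, hk₁, k₂, hk₂, hu'⟩

/-- **THE MIDDLE COEFFICIENT FOR `U(2)`**: the left cosets `gK₀ ⊆ K₀tK₀` (`t = diag(ϖ, ϖ⁻¹)`) of Iwasawa exponent `0` number
`√Q - 1`: they are the `u(β)K₀`, `β` trace-zero with `v β = |ϖ⁻¹|`, modulo `L_0` — the non-zero classes of `L_1/L_0`.
[cite: CartierCorvallis1979, §IV (4.2)] [cite: Serre1979, Ch. V §2] -/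
theorem card_filter_iwasawaExp_basic_zero_two (hd : UnramifiedLocalConjDatum σ ϖ) (hσ : ∃ x : K, σ x ≠ x) [Finite 𝓀[K]]
    [IsHeckeTriple (⊤ : Submonoid (unitaryGroupOfForm σ ((StdForm.antidiagonal 2).over K))) (unitaryInt σ ((StdForm.antidiagonal 2).over K))
      (unitaryInt σ ((StdForm.antidiagonal 2).over K))]
    [DecidablePred fun α : unitaryGroupOfForm σ ((StdForm.antidiagonal 2).over K) ⧸ unitaryInt σ ((StdForm.antidiagonal 2).over K) =>
      hd.iwasawaExp α.out = (0 : Fin 2 → ℤ)] :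
    ((finite_orbit_quotient (unitaryInt σ ((StdForm.antidiagonal 2).over K))
        (⟨zpowDiagGL (uniformizer_ne_zero hd.vϖ) (fun i : Fin 2 => (1 : ℤ) * (1 - 2 * (i : ℕ))),
            zpowDiagGL_mem_unitaryGroupOfForm hd.σϖ _ (rev_linear_two 1)⟩ : unitaryGroupOfForm σ ((StdForm.antidiagonal 2).over K))).toFinset.filter
        fun α => hd.iwasawaExp α.out = (0 : Fin 2 → ℤ)).card = Nat.sqrt (Nat.card 𝓀[K]) - 1 := by
  classical
  have hϖ0 := uniformizer_ne_zero hd.vϖ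
  set t : unitaryGroupOfForm σ ((StdForm.antidiagonal 2).over K) :=
    ⟨zpowDiagGL (uniformizer_ne_zero hd.vϖ) (fun i : Fin 2 => (1 : ℤ) * (1 - 2 * (i : ℕ))),
      zpowDiagGL_mem_unitaryGroupOfForm hd.σϖ _ (rev_linear_two 1)⟩ with ht
  set S := ((finite_orbit_quotient (unitaryInt σ ((StdForm.antidiagonal 2).over K)) t).toFinset.filter
    fun α => hd.iwasawaExp α.out = (0 : Fin 2 → ℤ)) with hS
  have hmemS : ∀ α, α ∈ S ↔ α ∈ MulAction.orbit (unitaryInt σ ((StdForm.antidiagonal 2).over K))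
      (t : unitaryGroupOfForm σ ((StdForm.antidiagonal 2).over K) ⧸ unitaryInt σ ((StdForm.antidiagonal 2).over K)) ∧
        hd.iwasawaExp α.out = 0 := fun α => by
    rw [hS, Finset.mem_filter, Set.Finite.mem_toFinset]
  set L1 : AddSubgroup K := (Valued.v : Valuation K ℤᵐ⁰).leAddSubgroup (WithZero.exp (1 : ℤ)) ⊓ (AddMonoidHom.id K + σ.toAddMonoidHom).ker
    with hL1
  set L0 : AddSubgroup K := (Valued.v : Valuation K ℤᵐ⁰).leAddSubgroup (WithZero.exp (0 : ℤ)) ⊓ (AddMonoidHom.id K + σ.toAddMonoidHom).ker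
    with hL0
  have hmemL1 : ∀ β : K, β ∈ L1 ↔ Valued.v β ≤ WithZero.exp 1 ∧ β + σ β = 0 := fun β => by
    rw [hL1, AddSubgroup.mem_inf, Valuation.mem_leAddSubgroup_iff, mem_ker_id_add_iff]
  have hmemL0 : ∀ β : K, β ∈ L0 ↔ Valued.v β ≤ 1 ∧ β + σ β = 0 := fun β => by
    rw [hL0, AddSubgroup.mem_inf, Valuation.mem_leAddSubgroup_iff, mem_ker_id_add_iff, WithZero.exp_zero]
  have hidx : L0.relIndex L1 = Nat.sqrt (Nat.card 𝓀[K]) := by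
    rw [hL0, hL1, hd.relIndex_leAddSubgroup_inf_ker_add_exp hσ 1 0]; simp
  -- the unipotent section `β ↦ u(β)`
  have hex : ∀ β : L1, ∃ g : unitaryGroupOfForm σ ((StdForm.antidiagonal 2).over K), (g : GL (Fin 2) K) ∈ upperUnitriangular (Fin 2) K ∧
      ((g : GL (Fin 2) K) : Matrix (Fin 2) (Fin 2) K) 0 1 = (β : K) := fun β =>
    hd.exists_unitriangular_apply_eq_two ((hmemL1 β).1 β.2).2
  choose u huU hu01 using hex
  have hσβ : ∀ β : L1, σ (β : K) = -(β : K) := fun β => by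
    have := ((hmemL1 β).1 β.2).2; linear_combination this
  have hvβ : ∀ β : L1, Valued.v (β : K) ≤ WithZero.exp 1 := fun β => ((hmemL1 β).1 β.2).1
  have hau : ∀ β : L1, hd.iwasawaExp (u β) = 0 := fun β => by
    have := hd.iwasawaExp_unipotent_mul_torus (huU β) (t := 1) (a := 0) (by rw [OneMemClass.coe_one, zpowDiagGL_zero])
    rwa [mul_one] at this
  -- (F1) fibres
  have hF1 : ∀ β β' : L1,
      ((u β : unitaryGroupOfForm σ ((StdForm.antidiagonal 2).over K)) :
          unitaryGroupOfForm σ ((StdForm.antidiagonal 2).over K) ⧸ unitaryInt σ ((StdForm.antidiagonal 2).over K)) = (u β' : _) ↔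
        Valued.v ((β' : K) - β) ≤ 1 := fun β β' => by
    rw [QuotientGroup.eq, hd.mem_unitaryInt_iff_of_unitriangular_two (inv_mul_mem_upperUnitriangular_two (huU β) (huU β')),
      inv_mul_apply_zero_one_two (huU β) (huU β'), hu01, hu01, hσβ, ← sub_eq_add_neg]
  -- (F2)
  have hF2 : ∀ β : L1, ((u β : unitaryGroupOfForm σ ((StdForm.antidiagonal 2).over K)) :
      unitaryGroupOfForm σ ((StdForm.antidiagonal 2).over K) ⧸ unitaryInt σ ((StdForm.antidiagonal 2).over K)) ∈ S ↔
        ¬ Valued.v (β : K) ≤ 1 := fun β => by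
    rw [hmemS, ht, hd.coe_mem_orbit_basic_iff_two (huU β), hu01]
    obtain ⟨k, hk⟩ := QuotientGroup.mk_out_eq_mul (unitaryInt σ ((StdForm.antidiagonal 2).over K)) (u β)
    rw [hk, hd.iwasawaExp_mul_of_mem_unitaryInt _ k.2, hau]
    exact ⟨fun h => h.1.2, fun h => ⟨⟨hvβ β, h⟩, rfl⟩⟩
  -- (F3)
  have hF3 : ∀ α ∈ S, ∃ β : L1, ((u β : unitaryGroupOfForm σ ((StdForm.antidiagonal 2).over K)) :
      unitaryGroupOfForm σ ((StdForm.antidiagonal 2).over K) ⧸ unitaryInt σ ((StdForm.antidiagonal 2).over K)) = α := fun α hα => by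
    obtain ⟨horb, ha0⟩ := (hmemS α).1 hα
    obtain ⟨p, hp, k, hk, hgpk⟩ := hd.isIwasawaExponent.exists_eq_mul α.out
    have hap : hd.iwasawaExp p = 0 := by rw [← ha0, hgpk, hd.iwasawaExp_mul_of_mem_unitaryInt _ hk]
    have hpU := hd.coe_mem_upperUnitriangular_of_iwasawaExp_eq_zero hp hap
    have hpα : ((p : unitaryGroupOfForm σ ((StdForm.antidiagonal 2).over K)) :
        unitaryGroupOfForm σ ((StdForm.antidiagonal 2).over K) ⧸ unitaryInt σ ((StdForm.antidiagonal 2).over K)) = α := by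
      rw [← QuotientGroup.out_eq' α, QuotientGroup.eq, hgpk, inv_mul_cancel_left]
      exact hk
    rw [← hpα, ht, hd.coe_mem_orbit_basic_iff_two hpU] at horb
    have hrel := apply_add_map_apply_eq_two hpU
    have hβmem : ((p : GL (Fin 2) K) : Matrix (Fin 2) (Fin 2) K) 0 1 ∈ L1 := (hmemL1 _).2 ⟨horb.1, hrel⟩
    refine ⟨⟨_, hβmem⟩, ?_⟩
    rw [← hpα, QuotientGroup.eq, hd.mem_unitaryInt_iff_of_unitriangular_two (inv_mul_mem_upperUnitriangular_two (huU _) hpU),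
      inv_mul_apply_zero_one_two (huU _) hpU, hu01]
    show Valued.v (((p : GL (Fin 2) K) : Matrix (Fin 2) (Fin 2) K) 0 1 + σ (((p : GL (Fin 2) K) : Matrix (Fin 2) (Fin 2) K) 0 1)) ≤ 1
    rw [hrel, map_zero]; exact zero_le
  -- (F4) counting through `L_1/L_0`
  set L0' : AddSubgroup L1 := L0.addSubgroupOf L1 with hL0'
  have hne : Nat.sqrt (Nat.card 𝓀[K]) ≠ 0 := (Nat.sqrt_pos.2 Nat.card_pos).ne'
  haveI hfin : Fintype (L1 ⧸ L0') := AddSubgroup.fintypeOfIndexNeZero (by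
    show L0.relIndex L1 ≠ 0
    rw [hidx]; exact hne)
  let F : L1 ⧸ L0' → unitaryGroupOfForm σ ((StdForm.antidiagonal 2).over K) ⧸ unitaryInt σ ((StdForm.antidiagonal 2).over K) :=
    Quotient.lift (s := QuotientAddGroup.leftRel L0')
      (fun β : L1 => ((u β : unitaryGroupOfForm σ ((StdForm.antidiagonal 2).over K)) :
        unitaryGroupOfForm σ ((StdForm.antidiagonal 2).over K) ⧸ unitaryInt σ ((StdForm.antidiagonal 2).over K))) fun β β' h => by
      have h' : -β + β' ∈ L0' := QuotientAddGroup.leftRel_apply.mp h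
      rw [hL0', AddSubgroup.mem_addSubgroupOf, hmemL0] at h'
      show ((u β : unitaryGroupOfForm σ ((StdForm.antidiagonal 2).over K)) :
        unitaryGroupOfForm σ ((StdForm.antidiagonal 2).over K) ⧸ unitaryInt σ ((StdForm.antidiagonal 2).over K)) = (u β' : _)
      rw [hF1]
      have hc : ((-β + β' : L1) : K) = (β' : K) - β := by rw [AddSubgroup.coe_add, AddSubgroup.coe_neg]; ring
      rw [← hc]; exact h'.1
  have hFmk : ∀ β : L1, F (β : L1 ⧸ L0') = ((u β : unitaryGroupOfForm σ ((StdForm.antidiagonal 2).over K)) :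
      unitaryGroupOfForm σ ((StdForm.antidiagonal 2).over K) ⧸ unitaryInt σ ((StdForm.antidiagonal 2).over K)) := fun β => rfl
  have hFinj : Function.Injective F := by
    intro x y hxy
    obtain ⟨β, rfl⟩ := QuotientAddGroup.mk_surjective x
    obtain ⟨β', rfl⟩ := QuotientAddGroup.mk_surjective y
    rw [hFmk, hFmk, hF1] at hxy
    refine QuotientAddGroup.eq.2 ?_
    rw [hL0', AddSubgroup.mem_addSubgroupOf, hmemL0]
    have hc : ((-β + β' : L1) : K) = (β' : K) - β := by rw [AddSubgroup.coe_add, AddSubgroup.coe_neg]; ring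
    rw [hc]
    exact ⟨hxy, by rw [map_sub, hσβ, hσβ]; ring⟩
  have hnot : ((u 0 : unitaryGroupOfForm σ ((StdForm.antidiagonal 2).over K)) :
      unitaryGroupOfForm σ ((StdForm.antidiagonal 2).over K) ⧸ unitaryInt σ ((StdForm.antidiagonal 2).over K)) ∉ S := fun h =>
    (hF2 0).1 h (by rw [ZeroMemClass.coe_zero, map_zero]; exact zero_le)
  have himage : Finset.univ.image F = insert ((u 0 : unitaryGroupOfForm σ ((StdForm.antidiagonal 2).over K)) :
      unitaryGroupOfForm σ ((StdForm.antidiagonal 2).over K) ⧸ unitaryInt σ ((StdForm.antidiagonal 2).over K)) S := by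
    ext α
    rw [Finset.mem_image, Finset.mem_insert]
    constructor
    · rintro ⟨x, -, rfl⟩
      obtain ⟨β, rfl⟩ := QuotientAddGroup.mk_surjective x
      rw [hFmk]
      by_cases hβ : Valued.v (β : K) ≤ 1
      · left
        rw [hF1, ZeroMemClass.coe_zero, zero_sub, Valuation.map_neg]
        exact hβ
      · right
        exact (hF2 β).2 hβ
    · rintro (rfl | hα)
      · exact ⟨((0 : L1) : L1 ⧸ L0'), Finset.mem_univ _, hFmk 0⟩
      · obtain ⟨β, hβ⟩ := hF3 α hα
        exact ⟨(β : L1 ⧸ L0'), Finset.mem_univ _, by rw [hFmk, hβ]⟩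
  have hcard : (Finset.univ.image F).card = Nat.sqrt (Nat.card 𝓀[K]) := by
    rw [Finset.card_image_of_injective _ hFinj, Finset.card_univ, ← Nat.card_eq_fintype_card, ← AddSubgroup.index_eq_card]
    exact hidx
  rw [himage, Finset.card_insert_of_notMem hnot] at hcard
  omega

section BasicTwo

variable [Finite 𝓀[K]]
  [IsHeckeTriple (⊤ : Submonoid (unitaryGroupOfForm σ ((StdForm.antidiagonal 2).over K))) (unitaryInt σ ((StdForm.antidiagonal 2).over K))
    (unitaryInt σ ((StdForm.antidiagonal 2).over K))]

/-- The line `ℓ_m = (m, -m)` is injective in `m`. [folklore] -/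
private theorem line_two_inj {a b : ℤ} :
    ((fun i : Fin 2 => a * (1 - 2 * (i : ℕ))) = fun i : Fin 2 => b * (1 - 2 * (i : ℕ))) ↔ a = b :=
  ⟨fun h => by have := congrFun h 0; simpa using this, fun h => by rw [h]⟩

/-- **The bottom coefficient** (`U(2)`): `𝒮(1_{K₀tK₀})_{(-1,1)} = √Q` (one coset `tK₀`, weight `δ^{½}(t) = √Q = q_F`).
[cite: CartierCorvallis1979, §IV (4.2)] [cite: BruhatTits1972, (4.4.4) (ii)] -/
theorem coeff_satakeTransform_basic_neg_two (hd : UnramifiedLocalConjDatum σ ϖ) (hσ : ∃ x : K, σ x ≠ x) :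
    (hd.satakeTransform (heckeAlgebra.doubleCosetOperator (unitaryInt σ ((StdForm.antidiagonal 2).over K))
        (⟨zpowDiagGL (uniformizer_ne_zero hd.vϖ) (fun i : Fin 2 => (1 : ℤ) * (1 - 2 * (i : ℕ))),
          zpowDiagGL_mem_unitaryGroupOfForm hd.σϖ _ (rev_linear_two 1)⟩ : unitaryGroupOfForm σ ((StdForm.antidiagonal 2).over K)))).coeff
        (fun i : Fin 2 => (-1 : ℤ) * (1 - 2 * (i : ℕ))) = (Nat.sqrt (Nat.card 𝓀[K]) : ℂ) := by
  have hℓ : (fun i : Fin 2 => (-1 : ℤ) * (1 - 2 * (i : ℕ))) = fun i => -((fun i : Fin 2 => (1 : ℤ) * (1 - 2 * (i : ℕ))) i) :=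
    funext fun i => by ring
  rw [hd.satakeTransform_eq_isIwasawaExponent_satakeTransform, hℓ,
    hd.coeff_satakeTransform_doubleCosetOperator_neg _ ⟨antitone_linear_two 1 zero_le_one, rev_linear_two 1⟩, satakeWeightHom_ofAdd,
    satakeWeight, satakeTwistExp_eq_two]
  have he : -(-((1 : ℤ) * (1 - 2 * (((0 : Fin 2) : ℕ) : ℤ)))) = 1 := by norm_num
  rw [he, zpow_one, hd.residueCardSqrt_eq_natCast_sqrt hσ]

/-- **The top coefficient** (`U(2)`): `𝒮(1_{K₀tK₀})_{(1,-1)} = √Q`. [cite: CartierCorvallis1979, §IV (4.2), Thm. 4.1] -/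
theorem coeff_satakeTransform_basic_pos_two (hd : UnramifiedLocalConjDatum σ ϖ) (hσ : ∃ x : K, σ x ≠ x) :
    (hd.satakeTransform (heckeAlgebra.doubleCosetOperator (unitaryInt σ ((StdForm.antidiagonal 2).over K))
        (⟨zpowDiagGL (uniformizer_ne_zero hd.vϖ) (fun i : Fin 2 => (1 : ℤ) * (1 - 2 * (i : ℕ))),
          zpowDiagGL_mem_unitaryGroupOfForm hd.σϖ _ (rev_linear_two 1)⟩ : unitaryGroupOfForm σ ((StdForm.antidiagonal 2).over K)))).coeff
        (fun i : Fin 2 => (1 : ℤ) * (1 - 2 * (i : ℕ))) = (Nat.sqrt (Nat.card 𝓀[K]) : ℂ) := by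
  have hℓ : (-fun i : Fin 2 => (1 : ℤ) * (1 - 2 * (i : ℕ))) = fun i : Fin 2 => (-1 : ℤ) * (1 - 2 * (i : ℕ)) :=
    funext fun i => by simp only [Pi.neg_apply]; ring
  rw [← hd.coeff_satakeTransform_neg_two hσ, hℓ, hd.coeff_satakeTransform_basic_neg_two hσ]

/-- **The middle coefficient** (`U(2)`): `𝒮(1_{K₀tK₀})_0 = √Q - 1`. [cite: CartierCorvallis1979, §IV (4.2)] [cite: Serre1979, Ch. V §2] -/
theorem coeff_satakeTransform_basic_zero_two (hd : UnramifiedLocalConjDatum σ ϖ) (hσ : ∃ x : K, σ x ≠ x) :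
    (hd.satakeTransform (heckeAlgebra.doubleCosetOperator (unitaryInt σ ((StdForm.antidiagonal 2).over K))
        (⟨zpowDiagGL (uniformizer_ne_zero hd.vϖ) (fun i : Fin 2 => (1 : ℤ) * (1 - 2 * (i : ℕ))),
          zpowDiagGL_mem_unitaryGroupOfForm hd.σϖ _ (rev_linear_two 1)⟩ : unitaryGroupOfForm σ ((StdForm.antidiagonal 2).over K)))).coeff 0 =
      (Nat.sqrt (Nat.card 𝓀[K]) : ℂ) - 1 := by
  classical
  have h1 : 1 ≤ Nat.sqrt (Nat.card 𝓀[K]) := Nat.sqrt_pos.2 Nat.card_pos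
  rw [hd.coeff_satakeTransform_doubleCosetOperator, hd.card_filter_iwasawaExp_basic_zero_two hσ, satakeWeight, satakeTwistExp_zero,
    neg_zero, zpow_zero, mul_one, Nat.cast_sub h1, Nat.cast_one]

/-- **The support** (`U(2)`): `𝒮(1_{K₀tK₀})_{ℓ_m} = 0` for `m ∉ {-1, 0, 1}`. [cite: CartierCorvallis1979, §IV (4.2), (4.4)]
[cite: BruhatTits1972, (4.4.4) (i)] -/
theorem coeff_satakeTransform_basic_eq_zero_two (hd : UnramifiedLocalConjDatum σ ϖ) (hσ : ∃ x : K, σ x ≠ x) {m : ℤ}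
    (hm : m ≠ -1 ∧ m ≠ 0 ∧ m ≠ 1) :
    (hd.satakeTransform (heckeAlgebra.doubleCosetOperator (unitaryInt σ ((StdForm.antidiagonal 2).over K))
        (⟨zpowDiagGL (uniformizer_ne_zero hd.vϖ) (fun i : Fin 2 => (1 : ℤ) * (1 - 2 * (i : ℕ))),
          zpowDiagGL_mem_unitaryGroupOfForm hd.σϖ _ (rev_linear_two 1)⟩ : unitaryGroupOfForm σ ((StdForm.antidiagonal 2).over K)))).coeff
        (fun i : Fin 2 => m * (1 - 2 * (i : ℕ))) = 0 := by
  have hbound : ∀ n : ℤ, (hd.satakeTransform (heckeAlgebra.doubleCosetOperator (unitaryInt σ ((StdForm.antidiagonal 2).over K))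
      (⟨zpowDiagGL (uniformizer_ne_zero hd.vϖ) (fun i : Fin 2 => (1 : ℤ) * (1 - 2 * (i : ℕ))),
        zpowDiagGL_mem_unitaryGroupOfForm hd.σϖ _ (rev_linear_two 1)⟩ : unitaryGroupOfForm σ ((StdForm.antidiagonal 2).over K)))).coeff
        (fun i : Fin 2 => n * (1 - 2 * (i : ℕ))) ≠ 0 → -1 ≤ n := fun n hn => by
    rw [hd.satakeTransform_eq_isIwasawaExponent_satakeTransform] at hn
    have h := hd.forall_sum_ite_lt_neg_le_of_coeff_satakeTransform_ne_zero _ ⟨antitone_linear_two 1 zero_le_one, rev_linear_two 1⟩ hn 1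
    simp at h
    linarith
  by_contra hne
  have h1 := hbound m hne
  have hℓ : (-fun i : Fin 2 => m * (1 - 2 * (i : ℕ))) = fun i : Fin 2 => (-m) * (1 - 2 * (i : ℕ)) :=
    funext fun i => by simp only [Pi.neg_apply]; ring
  rw [← hd.coeff_satakeTransform_neg_two hσ, hℓ] at hne
  have h2 := hbound (-m) hne
  omega

/-- Coefficients of a scalar in `ℂ[ℤ²]`. [folklore] -/
private theorem coeff_algebraMap_two (c : ℂ) (μ : Fin 2 → ℤ) :
    (algebraMap ℂ (AddMonoidAlgebra ℂ (Fin 2 → ℤ)) c).coeff μ = if (0 : Fin 2 → ℤ) = μ then c else 0 := by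
  rw [Algebra.algebraMap_eq_smul_one, AddMonoidAlgebra.one_def, AddMonoidAlgebra.coeff_smul, Finsupp.smul_apply,
    AddMonoidAlgebra.coeff_single, Finsupp.single_apply, smul_eq_mul, mul_ite, mul_one, mul_zero]

/-- **THE BASIC HECKE OPERATOR OF `U(2)` EVALUATED**: for `t = diag(ϖ, ϖ⁻¹)` and `Q = #𝓀 = q_F²`,
`𝒮(1_{K₀tK₀}) = √Q · (x^{(1,-1)} + x^{(-1,1)}) + (√Q - 1) · 1` (on the `(q_F + 1)`-regular tree: one coset above, `q_F - 1` level,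
`q_F²` below). [cite: CartierCorvallis1979, §IV (4.2), Thm. 4.1] [cite: Rogawski1990, §4.5 p. 50] [cite: Satake1963, §§6–7] -/
theorem satakeTransform_doubleCosetOperator_basic_two (hd : UnramifiedLocalConjDatum σ ϖ) (hσ : ∃ x : K, σ x ≠ x) :
    hd.satakeTransform (heckeAlgebra.doubleCosetOperator (unitaryInt σ ((StdForm.antidiagonal 2).over K))
        (⟨zpowDiagGL (uniformizer_ne_zero hd.vϖ) (fun i : Fin 2 => (1 : ℤ) * (1 - 2 * (i : ℕ))),
          zpowDiagGL_mem_unitaryGroupOfForm hd.σϖ _ (rev_linear_two 1)⟩ : unitaryGroupOfForm σ ((StdForm.antidiagonal 2).over K))) =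
      (Nat.sqrt (Nat.card 𝓀[K]) : ℂ) • (AddMonoidAlgebra.single (fun i : Fin 2 => (1 : ℤ) * (1 - 2 * (i : ℕ))) (1 : ℂ) +
          AddMonoidAlgebra.single (fun i : Fin 2 => (-1 : ℤ) * (1 - 2 * (i : ℕ))) 1) +
        algebraMap ℂ (AddMonoidAlgebra ℂ (Fin 2 → ℤ)) ((Nat.sqrt (Nat.card 𝓀[K]) : ℂ) - 1) := by
  classical
  refine AddMonoidAlgebra.ext (Finsupp.ext fun μ => ?_)
  rw [AddMonoidAlgebra.coeff_add, Finsupp.add_apply, AddMonoidAlgebra.coeff_smul, Finsupp.smul_apply, AddMonoidAlgebra.coeff_add,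
    Finsupp.add_apply, AddMonoidAlgebra.coeff_single, AddMonoidAlgebra.coeff_single, Finsupp.single_apply, Finsupp.single_apply,
    coeff_algebraMap_two, smul_eq_mul]
  by_cases hμ : ∀ i, μ (Fin.rev i) = -μ i
  · obtain ⟨m, hm⟩ : ∃ m : ℤ, μ = fun i : Fin 2 => m * (1 - 2 * (i : ℕ)) := ⟨μ 0, eq_linear_two_of_rev μ hμ⟩
    subst hm
    have h0 : (0 : Fin 2 → ℤ) = fun i : Fin 2 => (0 : ℤ) * (1 - 2 * (i : ℕ)) := funext fun i => by simp
    rw [h0]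
    simp only [line_two_inj]
    by_cases h1 : m = 1
    · subst h1
      rw [if_pos rfl, if_neg (by norm_num), if_neg (by norm_num), hd.coeff_satakeTransform_basic_pos_two hσ]; ring
    by_cases h2 : m = -1
    · subst h2
      rw [if_neg (by norm_num), if_pos rfl, if_neg (by norm_num), hd.coeff_satakeTransform_basic_neg_two hσ]; ring
    by_cases h3 : m = 0
    · subst h3
      rw [if_neg (by norm_num), if_neg (by norm_num), if_pos rfl, ← h0, hd.coeff_satakeTransform_basic_zero_two hσ]; ring
    · rw [if_neg (Ne.symm h1), if_neg (Ne.symm h2), if_neg (Ne.symm h3), hd.coeff_satakeTransform_basic_eq_zero_two hσ ⟨h2, h3, h1⟩]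
      ring
  · have hne : ∀ a : ℤ, (fun i : Fin 2 => a * (1 - 2 * (i : ℕ))) ≠ μ := fun a h => hμ (h ▸ rev_linear_two a)
    have hne0 : (0 : Fin 2 → ℤ) ≠ μ := fun h => hμ (fun i => by rw [← h, Pi.zero_apply, Pi.zero_apply, neg_zero])
    rw [hd.satakeTransform_eq_isIwasawaExponent_satakeTransform, hd.coeff_satakeTransform_eq_zero_of_not_rev _ _ hμ,
      if_neg (hne 1), if_neg (hne (-1)), if_neg hne0]
    ring

/-- **THE HECKE EIGENVALUES OF THE BASIC OPERATOR OF `U(2)`**: `λ_β(1_{K₀tK₀}) = √Q(z + z⁻¹) + √Q - 1`, `z = β₀β₁⁻¹`.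
[cite: CartierCorvallis1979, §IV (4.2), Cor. 4.2] [cite: Rogawski1990, §4.5 p. 50] -/
theorem heckeEigencharacter_doubleCosetOperator_basic_two (hd : UnramifiedLocalConjDatum σ ϖ) (hσ : ∃ x : K, σ x ≠ x) (β : Fin 2 → ℂˣ) :
    hd.heckeEigencharacter β (heckeAlgebra.doubleCosetOperator (unitaryInt σ ((StdForm.antidiagonal 2).over K))
        (⟨zpowDiagGL (uniformizer_ne_zero hd.vϖ) (fun i : Fin 2 => (1 : ℤ) * (1 - 2 * (i : ℕ))),
          zpowDiagGL_mem_unitaryGroupOfForm hd.σϖ _ (rev_linear_two 1)⟩ : unitaryGroupOfForm σ ((StdForm.antidiagonal 2).over K))) =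
      (Nat.sqrt (Nat.card 𝓀[K]) : ℂ) * ((β 0 : ℂ) * (β 1 : ℂ)⁻¹ + ((β 0 : ℂ) * (β 1 : ℂ)⁻¹)⁻¹) + ((Nat.sqrt (Nat.card 𝓀[K]) : ℂ) - 1) := by
  have hz : ∀ e : ℤ, (∏ i : Fin 2, ((β i : ℂ) ^ (e * (1 - 2 * ((i : ℕ) : ℤ))))) = ((β 0 : ℂ) * (β 1 : ℂ)⁻¹) ^ e := fun e => by
    rw [Fin.prod_univ_two]
    simp only [Fin.val_zero, Fin.val_one, Nat.cast_zero, Nat.cast_one, mul_zero, sub_zero, mul_one, show (1 : ℤ) - 2 = -1 by norm_num,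
      mul_neg, mul_one, zpow_neg, mul_zpow, inv_zpow]
  rw [hd.heckeEigencharacter_apply, hd.satakeTransform_doubleCosetOperator_basic_two hσ, map_add, map_smul, AlgHom.commutes,
    Algebra.algebraMap_self_apply, map_add, laurentEvalAt_single, laurentEvalAt_single, one_mul, one_mul, hz, hz, zpow_one,
    zpow_neg, zpow_one, smul_eq_mul]

/-- **Every complex number is a Hecke eigenvalue of the basic operator of `U(2)`.** [cite: CartierCorvallis1979, §IV Cor. 4.2] -/
theorem exists_heckeEigencharacter_doubleCosetOperator_eq_two (hd : UnramifiedLocalConjDatum σ ϖ) (hσ : ∃ x : K, σ x ≠ x) (c₀ : ℂ) :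
    ∃ β : Fin 2 → ℂˣ, hd.heckeEigencharacter β (heckeAlgebra.doubleCosetOperator (unitaryInt σ ((StdForm.antidiagonal 2).over K))
        (⟨zpowDiagGL (uniformizer_ne_zero hd.vϖ) (fun i : Fin 2 => (1 : ℤ) * (1 - 2 * (i : ℕ))),
          zpowDiagGL_mem_unitaryGroupOfForm hd.σϖ _ (rev_linear_two 1)⟩ : unitaryGroupOfForm σ ((StdForm.antidiagonal 2).over K))) = c₀ := by
  have hQ : (Nat.sqrt (Nat.card 𝓀[K]) : ℂ) ≠ 0 := Nat.cast_ne_zero.2 (Nat.sqrt_pos.2 Nat.card_pos).ne'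
  obtain ⟨z, hz⟩ := exists_units_add_inv_eq ((c₀ - ((Nat.sqrt (Nat.card 𝓀[K]) : ℂ) - 1)) / Nat.sqrt (Nat.card 𝓀[K]))
  refine ⟨fun i => if i = 0 then z else 1, ?_⟩
  rw [hd.heckeEigencharacter_doubleCosetOperator_basic_two hσ, if_pos rfl, if_neg (by decide), Units.val_one, inv_one, mul_one, hz]
  field_simp
  ring

set_option synthInstance.maxHeartbeats 200000 in
/-- **`1_{K₀tK₀} = √Q · T₁ + (√Q - 1)`** (`U(2)`) for the generator `T₁` of g46-#5. [cite: CartierCorvallis1979, §IV Thm. 4.1] -/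
theorem doubleCosetOperator_basic_eq_two (hd : UnramifiedLocalConjDatum σ ϖ) (hσ : ∃ x : K, σ x ≠ x)
    {T₁ : heckeAlgebra ℂ (unitaryGroupOfForm σ ((StdForm.antidiagonal 2).over K)) (unitaryInt σ ((StdForm.antidiagonal 2).over K))}
    (hT₁ : hd.satakeTransform T₁ = AddMonoidAlgebra.single (fun i : Fin 2 => (1 : ℤ) * (1 - 2 * (i : ℕ))) (1 : ℂ) +
      AddMonoidAlgebra.single (fun i : Fin 2 => (-1 : ℤ) * (1 - 2 * (i : ℕ))) 1) :
    heckeAlgebra.doubleCosetOperator (unitaryInt σ ((StdForm.antidiagonal 2).over K))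
        (⟨zpowDiagGL (uniformizer_ne_zero hd.vϖ) (fun i : Fin 2 => (1 : ℤ) * (1 - 2 * (i : ℕ))),
          zpowDiagGL_mem_unitaryGroupOfForm hd.σϖ _ (rev_linear_two 1)⟩ : unitaryGroupOfForm σ ((StdForm.antidiagonal 2).over K)) =
      (Nat.sqrt (Nat.card 𝓀[K]) : ℂ) • T₁ + algebraMap ℂ _ ((Nat.sqrt (Nat.card 𝓀[K]) : ℂ) - 1) :=
  hd.satakeTransform_injective (by
    rw [hd.satakeTransform_doubleCosetOperator_basic_two hσ, Algebra.smul_def, Algebra.smul_def]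
    simp only [map_add, map_mul, AlgHom.commutes, hT₁])

/-- **`ℋ(U(2), K₀) = ℂ[1_{K₀tK₀}]`**: every Hecke operator is a polynomial in the basic one.
[cite: CartierCorvallis1979, §IV Thm. 4.1, Cor. 4.2] [cite: Satake1963, §§6–7] -/
theorem exists_aeval_doubleCosetOperator_basic_two (hd : UnramifiedLocalConjDatum σ ϖ) (hσ : ∃ x : K, σ x ≠ x)
    (T : heckeAlgebra ℂ (unitaryGroupOfForm σ ((StdForm.antidiagonal 2).over K)) (unitaryInt σ ((StdForm.antidiagonal 2).over K))) :
    ∃ P : ℂ[X], aeval (heckeAlgebra.doubleCosetOperator (k := ℂ) (unitaryInt σ ((StdForm.antidiagonal 2).over K))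
        (⟨zpowDiagGL (uniformizer_ne_zero hd.vϖ) (fun i : Fin 2 => (1 : ℤ) * (1 - 2 * (i : ℕ))),
          zpowDiagGL_mem_unitaryGroupOfForm hd.σϖ _ (rev_linear_two 1)⟩ : unitaryGroupOfForm σ ((StdForm.antidiagonal 2).over K))) P = T := by
  obtain ⟨T₁, hT₁, hgen⟩ := hd.exists_generator_two hσ
  have hQ : (Nat.sqrt (Nat.card 𝓀[K]) : ℂ) ≠ 0 := Nat.cast_ne_zero.2 (Nat.sqrt_pos.2 Nat.card_pos).ne'
  have hc := hd.doubleCosetOperator_basic_eq_two hσ hT₁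
  set c := heckeAlgebra.doubleCosetOperator (k := ℂ) (unitaryInt σ ((StdForm.antidiagonal 2).over K))
    (⟨zpowDiagGL (uniformizer_ne_zero hd.vϖ) (fun i : Fin 2 => (1 : ℤ) * (1 - 2 * (i : ℕ))),
      zpowDiagGL_mem_unitaryGroupOfForm hd.σϖ _ (rev_linear_two 1)⟩ : unitaryGroupOfForm σ ((StdForm.antidiagonal 2).over K)) with hcdef
  have h2 : aeval c (X - C ((Nat.sqrt (Nat.card 𝓀[K]) : ℂ) - 1)) = (Nat.sqrt (Nat.card 𝓀[K]) : ℂ) • T₁ := by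
    rw [map_sub, aeval_X, aeval_C]
    exact sub_eq_of_eq_add hc
  have hT₁c : T₁ = aeval c (C (Nat.sqrt (Nat.card 𝓀[K]) : ℂ)⁻¹ * (X - C ((Nat.sqrt (Nat.card 𝓀[K]) : ℂ) - 1))) := by
    rw [map_mul, aeval_C, h2, Algebra.algebraMap_eq_smul_one, smul_mul_assoc, one_mul, smul_smul, inv_mul_cancel₀ hQ, one_smul]
  obtain ⟨P, hP⟩ := hgen T
  exact ⟨P.comp (C (Nat.sqrt (Nat.card 𝓀[K]) : ℂ)⁻¹ * (X - C ((Nat.sqrt (Nat.card 𝓀[K]) : ℂ) - 1))), by rw [aeval_comp, ← hT₁c, hP]⟩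

/-- **An unramified character of `ℋ(U(2), K₀)` is determined by its value on the basic Hecke operator.**
[cite: CartierCorvallis1979, §IV Cor. 4.2] [cite: Rogawski1990, §4.5 p. 50] -/
theorem algHom_ext_doubleCosetOperator_basic_two (hd : UnramifiedLocalConjDatum σ ϖ) (hσ : ∃ x : K, σ x ≠ x) {B : Type*} [Semiring B]
    [Algebra ℂ B]
    {χ χ' : heckeAlgebra ℂ (unitaryGroupOfForm σ ((StdForm.antidiagonal 2).over K)) (unitaryInt σ ((StdForm.antidiagonal 2).over K)) →ₐ[ℂ] B}
    (h : χ (heckeAlgebra.doubleCosetOperator (unitaryInt σ ((StdForm.antidiagonal 2).over K))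
        (⟨zpowDiagGL (uniformizer_ne_zero hd.vϖ) (fun i : Fin 2 => (1 : ℤ) * (1 - 2 * (i : ℕ))),
          zpowDiagGL_mem_unitaryGroupOfForm hd.σϖ _ (rev_linear_two 1)⟩ : unitaryGroupOfForm σ ((StdForm.antidiagonal 2).over K))) =
      χ' (heckeAlgebra.doubleCosetOperator (unitaryInt σ ((StdForm.antidiagonal 2).over K))
        (⟨zpowDiagGL (uniformizer_ne_zero hd.vϖ) (fun i : Fin 2 => (1 : ℤ) * (1 - 2 * (i : ℕ))),
          zpowDiagGL_mem_unitaryGroupOfForm hd.σϖ _ (rev_linear_two 1)⟩ : unitaryGroupOfForm σ ((StdForm.antidiagonal 2).over K)))) :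
    χ = χ' := by
  refine AlgHom.ext fun T => ?_
  obtain ⟨P, rfl⟩ := hd.exists_aeval_doubleCosetOperator_basic_two hσ T
  rw [← aeval_algHom_apply, ← aeval_algHom_apply, h]

/-- **THE DEGREE OF THE BASIC HECKE OPERATOR OF `U(2)`**: `#(K₀tK₀/K₀) = Q + √Q` (`= q_F² + q_F`, the vertices at distance `2` in
the `(q_F + 1)`-regular tree; the eigenvalue at the trivial point `z = √Q`). [cite: CartierCorvallis1979, §IV (4.2)–(4.4)]
[cite: ShimuraIATAF1971, §3.1 Prop. 3.3] -/
theorem card_orbit_basic_two (hd : UnramifiedLocalConjDatum σ ϖ) (hσ : ∃ x : K, σ x ≠ x) :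
    (finite_orbit_quotient (unitaryInt σ ((StdForm.antidiagonal 2).over K))
        (⟨zpowDiagGL (uniformizer_ne_zero hd.vϖ) (fun i : Fin 2 => (1 : ℤ) * (1 - 2 * (i : ℕ))),
          zpowDiagGL_mem_unitaryGroupOfForm hd.σϖ _ (rev_linear_two 1)⟩ : unitaryGroupOfForm σ ((StdForm.antidiagonal 2).over K))).toFinset.card =
      Nat.card 𝓀[K] + Nat.sqrt (Nat.card 𝓀[K]) := by
  have hsq := hd.sqrt_card_residueField_mul_self hσ
  have hq : (Nat.sqrt (Nat.card 𝓀[K]) : ℂ) ≠ 0 := Nat.cast_ne_zero.2 (Nat.sqrt_pos.2 Nat.card_pos).ne'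
  have h := hd.heckeEigencharacter_trivialPoint_doubleCosetOperator (N := 2)
    (⟨zpowDiagGL (uniformizer_ne_zero hd.vϖ) (fun i : Fin 2 => (1 : ℤ) * (1 - 2 * (i : ℕ))),
      zpowDiagGL_mem_unitaryGroupOfForm hd.σϖ _ (rev_linear_two 1)⟩ : unitaryGroupOfForm σ ((StdForm.antidiagonal 2).over K))
  rw [hd.heckeEigencharacter_doubleCosetOperator_basic_two hσ] at h
  simp only [Units.val_mk0] at h
  have e0 : (((2 : ℕ) : ℤ) - 1 - (((0 : Fin 2) : ℕ) : ℤ)) = 1 := by norm_num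
  have e1 : (((2 : ℕ) : ℤ) - 1 - (((1 : Fin 2) : ℕ) : ℤ)) = 0 := by norm_num
  rw [e0, e1, zpow_zero, inv_one, mul_one, zpow_one, hd.residueCardSqrt_eq_natCast_sqrt hσ] at h
  have h' : ((Nat.card 𝓀[K] : ℂ)) + (Nat.sqrt (Nat.card 𝓀[K]) : ℂ) =
      ((finite_orbit_quotient (unitaryInt σ ((StdForm.antidiagonal 2).over K))
        (⟨zpowDiagGL (uniformizer_ne_zero hd.vϖ) (fun i : Fin 2 => (1 : ℤ) * (1 - 2 * (i : ℕ))),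
          zpowDiagGL_mem_unitaryGroupOfForm hd.σϖ _ (rev_linear_two 1)⟩ : unitaryGroupOfForm σ ((StdForm.antidiagonal 2).over K))).toFinset.card : ℂ) := by
    have hQ : (Nat.card 𝓀[K] : ℂ) = (Nat.sqrt (Nat.card 𝓀[K]) : ℂ) * Nat.sqrt (Nat.card 𝓀[K]) := by exact_mod_cast hsq.symm
    rw [← h, hQ]; field_simp; ring
  exact_mod_cast h'.symm

/-- **`P ↦ P(1_{K₀tK₀})` is injective** (`U(2)`). [cite: CartierCorvallis1979, §IV Thm. 4.1, Cor. 4.2] -/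
theorem aeval_doubleCosetOperator_basic_injective_two (hd : UnramifiedLocalConjDatum σ ϖ) (hσ : ∃ x : K, σ x ≠ x) :
    Function.Injective (aeval (R := ℂ) (heckeAlgebra.doubleCosetOperator (k := ℂ) (unitaryInt σ ((StdForm.antidiagonal 2).over K))
        (⟨zpowDiagGL (uniformizer_ne_zero hd.vϖ) (fun i : Fin 2 => (1 : ℤ) * (1 - 2 * (i : ℕ))),
          zpowDiagGL_mem_unitaryGroupOfForm hd.σϖ _ (rev_linear_two 1)⟩ : unitaryGroupOfForm σ ((StdForm.antidiagonal 2).over K)))) := by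
  refine (injective_iff_map_eq_zero _).2 fun P hP => Polynomial.funext fun c₀ => ?_
  obtain ⟨β, hβ⟩ := hd.exists_heckeEigencharacter_doubleCosetOperator_eq_two hσ c₀
  have h := congrArg (hd.heckeEigencharacter β) hP
  rw [← aeval_algHom_apply, hβ, map_zero, coe_aeval_eq_eval] at h
  rw [h, eval_zero]

/-- **`ℋ(U(2), K₀) ≅ ℂ[X]`, `X ↦ 1_{K₀tK₀}`**. [cite: CartierCorvallis1979, §IV Thm. 4.1] [cite: Satake1963, §§6–7] -/
theorem exists_algEquiv_polynomial_basic_two (hd : UnramifiedLocalConjDatum σ ϖ) (hσ : ∃ x : K, σ x ≠ x) :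
    ∃ e : ℂ[X] ≃ₐ[ℂ] heckeAlgebra ℂ (unitaryGroupOfForm σ ((StdForm.antidiagonal 2).over K)) (unitaryInt σ ((StdForm.antidiagonal 2).over K)),
      e X = heckeAlgebra.doubleCosetOperator (unitaryInt σ ((StdForm.antidiagonal 2).over K))
        (⟨zpowDiagGL (uniformizer_ne_zero hd.vϖ) (fun i : Fin 2 => (1 : ℤ) * (1 - 2 * (i : ℕ))),
          zpowDiagGL_mem_unitaryGroupOfForm hd.σϖ _ (rev_linear_two 1)⟩ : unitaryGroupOfForm σ ((StdForm.antidiagonal 2).over K)) :=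
  ⟨AlgEquiv.ofBijective _ ⟨hd.aeval_doubleCosetOperator_basic_injective_two hσ, fun T =>
    hd.exists_aeval_doubleCosetOperator_basic_two hσ T⟩, by rw [AlgEquiv.ofBijective_apply, aeval_X]⟩

end BasicTwo

end UnramifiedLocalConjDatum

end Literature.NumberTheory.Automorphic.HermitianLattice

end
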